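import Literature.Analysis.FunctionSpaces.TorusFourierCalculus
import Literature.Analysis.FunctionSpaces.TorusVectorParseval
import HarnessLib

/-!
# Vector trigonometric polynomials and Fourier truncation on the flat torus `T^d`

Trunk: FluidKinetic / function spaces on `T^d = UnitAddTorus d`. This file develops the finite
Fourier sums ("vector trigonometric polynomials")
`trigPoly S c = ∑_{k ∈ S} e_k • c k`, `e_k = UnitAddTorus.mFourier k`, `c k ∈ V` a complex normed
space, over a finite frequency set `S ⊆ ℤ^d`, and their real form
`realTrigPoly S c = Re ∘ trigPoly S c` with values in `EuclideanSpace ℝ d` — the ansatz and test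
functions of the Fourier–Galerkin method for the Navier–Stokes equations on `𝕋³`
(Robinson–Rodrigo–Sadowski 2016, §4.1 and proof of Thm. 4.11; Constantin–Foias 1988, Ch. 4,
(4.13)–(4.14) and Ch. 8, (8.3); Hopf 1951, §2), together with the frequency balls
`freqBall N = {k : |k|² ≤ N²}` and the Fourier truncations `P_N`.

## Contents (all proved)

* `EuclideanSpace.realPart`, `EuclideanSpace.conjVec` — coordinatewise real part `ℂ^ι →L[ℝ] ℝ^ι` and
  complex conjugation on `ℂ^ι`, with the reality criterion
  `complexify (realPart w) = w ↔ conjVec w = w`.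
* `Torus.freqBall N` — the finite set of frequencies `k ∈ ℤ^d` with `|k|² ≤ N²` (all of them,
  the mean mode `k = 0` included, unlike `Torus.galerkinIndex` of `StokesTorus`), symmetric under
  `k ↦ -k`, exhausting `ℤ^d`.
* `Torus.integral_mFourier`, `Torus.integral_mFourier_neg_mul_mFourier` — orthonormality of the
  characters for H21's global `volume` (Grafakos 2014, Prop. 3.2.7 (1) proof / (3.1.5)).
* `Torus.trigPoly S c` — smoothness, Fourier coefficients
  (`mFourierCoeff (trigPoly S c) k = c k` on `S`, `0` off `S`), partial derivatives act
  diagonally (`∂ⱼ ↦ 2πi kⱼ`), and the finite Parseval identity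
  `∫ ⟪trigPoly S c, trigPoly S c'⟫ = ∑_{k∈S} ⟪c k, c' k⟫`.
* `Torus.IsConjSymm c` (`c (-k) = conjVec (c k)`), `Torus.realTrigPoly S c` — for conj-symmetric
  coefficients on a symmetric `S`, `complexify ∘ realTrigPoly S c = trigPoly S c`, whence its
  Fourier coefficients, `L²` norm (`∫ ‖·‖² = ∑ ‖c k‖²`), kinetic energy, inner products against
  `L²` fields, partial derivatives and divergence (`IsTransversal c`, `∑ⱼ kⱼ (c k)ⱼ = 0`, gives
  `Torus.IsDivFree`).
* `Torus.fourierTruncate N u = P_N u := realTrigPoly (freqBall N) û`, `û = 𝓕(complexify ∘ u)` —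
  the Fourier (Galerkin) truncation of a real `L²` vector field (Robinson–Rodrigo–Sadowski 2016,
  §4.1, `P_n`; Constantin–Foias 1988, (8.3)): smooth; coefficients `û(k)` on the ball and `0`
  outside (`mFourierCoeff_fourierTruncate`); `⟪P_N u, a⟫_{L²} = ⟪u, a⟫_{L²}` for `a ∈ L²`
  band-limited to `N` (`integral_inner_fourierTruncate_eq`); Bessel
  `∫ ‖P_N u‖² = ∑_{|k|≤N} ‖û k‖² ≤ ∫ ‖u‖²`; and **`P_N u → u` in `L²`**
  (`tendsto_eLpNorm_fourierTruncate_sub`; RRS 2016, Lemma 4.1: the Parseval tail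
  `∑_{|k|>N} ‖û k‖²` tends to `0`).
* `Torus.IsWeaklyDivFree.sum_mul_mFourierCoeff_eq_zero` — **weakly divergence-free `L²` fields
  have transversal Fourier coefficients**, `∑ⱼ kⱼ û(k)ⱼ = 0` (test `∫ ⟪u, ∇θ⟫ = 0` against
  `θ = Re (z e_{-k})`, `z ∈ {1, i}`; RRS 2016, Ex. 2.14, solution p. 310, and Def. 2.1, p. 42;
  the converse is Lemma 2.3);
  `Torus.IsDivFree.sum_mul_mFourierCoeff_eq_zero` — the same for smooth classically
  divergence-free fields (`𝓕(div a)(k) = 2πi k · â(k)`); hence `Torus.isDivFree_fourierTruncate`: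
  **`P_N u` is divergence free** for weakly divergence-free `u` (the truncation commutes with the
  Leray projector, which commutes with derivatives, RRS 2016, Lemma 2.9, p. 45; CF 1988, (8.4)).

* `Torus.coeffExt`, `Torus.IsRealCoeff`, `Torus.IsSolenoidalCoeff` — coefficient vectors on
  the finite type `↥S` (the phase space `↥S → ℂ^d` of the Galerkin systems), their extension by
  zero to `ℤ^d`, the dictionary with `IsConjSymm` / `IsTransversal`, norm comparisons
  (`‖c‖_∞² ≤ ∑ ‖c k‖² ≤ #S ‖c‖_∞²`), and the symmetrisation `Torus.symmetrise` (a real-linear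
  retraction onto the real vectors) — bookkeeping for the Galerkin systems.

The bound `(k i)² ≤ |k|²` used in `mem_freqBall` is `Literature.Analysis.FluidPDE.Torus.sq_apply_le_freqNormSq` of
`Literature/Analysis/FluidPDE/StokesTorus` (FluidPDE layer, not importable here); it is inlined
(`Finset.single_le_sum`) rather than duplicated.

## Mathlib search

Mathlib (this pin) has the characters `UnitAddTorus.mFourier`, their span
(`span_mFourier_closure_eq_top`), orthonormality in `L²` for the *local* Haar volume
(`orthonormal_mFourier`) and the Hilbert basis `mFourierBasis`; it has no trigonometric-polynomial
calculus (derivatives, real forms, truncation operators on functions) — searched `trigPoly`,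
`truncat`, `mFourier.*deriv`: none. Real part / conjugation on `EuclideanSpace ℂ ι`: none
(`Literature.Analysis.FluidPDE.realPart` of `TaoAveragedEuler` is the same map as a bare function; this file's
`EuclideanSpace.realPart` is the bundled `→L[ℝ]` version in the function-space layer, on which the
former can be re-based). In the tree, `Torus.galerkinProj` of `Literature/Analysis/FluidPDE/StokesTorus`
is a different object (an `Lp`-class projection onto mean-zero Stokes modes, `Torus.galerkinIndex`
excluding `k = 0`), not the function-level truncation `Torus.fourierTruncate` of this file.

## References

* J. C. Robinson, J. L. Rodrigo, W. Sadowski, *The three-dimensional Navier–Stokes equations*,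
  CUP 2016, §1.5 (1.10) (p. 27), Def. 2.1 and Lemma 2.3 (p. 42), Lemma 2.9 (p. 45), Ex. 2.14
  (solution p. 310), §4.1 (4.1) (p. 71), Lemma 4.1 and p. 74, Thm. 4.11 (proof).
* P. Constantin, C. Foias, *Navier–Stokes Equations*, Chicago 1988, Ch. 4 (4.13)–(4.14),
  Ch. 8 (8.3)–(8.4).
* L. Grafakos, *Classical Fourier Analysis*, 3rd ed., GTM 249 (2014), §3.1.1, Prop. 3.2.6,
  Prop. 3.2.7.
-/

open MeasureTheory Set Filter Topology UnitAddTorus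
open scoped ENNReal NNReal InnerProductSpace ContDiff

noncomputable section

namespace Literature.Analysis.FunctionSpaces

/-! ## Real part and conjugation on `ℂ^ι` -/

namespace EuclideanSpace

variable {ι : Type*}

/-- Coordinatewise **complex conjugation** on `ℂ^ι`. [folklore] -/
def conjVec (w : EuclideanSpace ℂ ι) : EuclideanSpace ℂ ι :=
  WithLp.toLp 2 fun i => starRingEnd ℂ (w i)

/-- Coordinates of the conjugate: `(conjVec w) i = conj (w i)`. [folklore] -/
@[simp]
theorem conjVec_apply (w : EuclideanSpace ℂ ι) (i : ι) : conjVec w i = starRingEnd ℂ (w i) := rfl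

/-- Conjugation is an involution. [folklore] -/
@[simp]
theorem conjVec_conjVec (w : EuclideanSpace ℂ ι) : conjVec (conjVec w) = w := by
  ext i; simp

/-- Conjugation is additive. [folklore] -/
theorem conjVec_add (v w : EuclideanSpace ℂ ι) : conjVec (v + w) = conjVec v + conjVec w := by
  ext i; simp

/-- `conj 0 = 0`. [folklore] -/
@[simp]
theorem conjVec_zero : conjVec (0 : EuclideanSpace ℂ ι) = 0 := by
  ext i; simp

/-- Conjugation is conjugate-linear: `conjVec (a • w) = conj a • conjVec w`. [folklore] -/
theorem conjVec_smul (a : ℂ) (w : EuclideanSpace ℂ ι) : conjVec (a • w) = starRingEnd ℂ a • conjVec w := by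
  ext i; simp

/-- Conjugation commutes with negation. [folklore] -/
theorem conjVec_neg (w : EuclideanSpace ℂ ι) : conjVec (-w) = -conjVec w := by
  ext i; simp

/-- Conjugation is additive: differences. [folklore] -/
theorem conjVec_sub (v w : EuclideanSpace ℂ ι) : conjVec (v - w) = conjVec v - conjVec w := by
  ext i; simp

/-- Conjugation of finite sums. [folklore] -/
theorem conjVec_sum {α : Type*} (s : Finset α) (f : α → EuclideanSpace ℂ ι) :
    conjVec (∑ a ∈ s, f a) = ∑ a ∈ s, conjVec (f a) := by
  ext i; simp [Finset.sum_apply]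

variable [Fintype ι]

/-- The coordinatewise **real part** `ℂ^ι → ℝ^ι`, `w ↦ (i ↦ Re (w i))`, as a continuous
`ℝ`-linear map; left inverse of the complexification `EuclideanSpace.complexify`
(`realPart_complexify`). Same underlying function as `Literature.Analysis.FluidPDE.realPart` (`TaoAveragedEuler`),
bundled. [folklore] -/
def realPart : EuclideanSpace ℂ ι →L[ℝ] EuclideanSpace ℝ ι :=
  LinearMap.mkContinuous
    { toFun := fun w => WithLp.toLp 2 fun i => (w i).re
      map_add' := fun v w => by ext i; simp
      map_smul' := fun c w => by ext i; simp }
    1 fun w => by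
      rw [one_mul, EuclideanSpace.norm_eq, EuclideanSpace.norm_eq]
      gcongr with i
      simp only [LinearMap.coe_mk, AddHom.coe_mk, Real.norm_eq_abs]
      exact Complex.abs_re_le_norm (w i)

/-- Coordinates of the real part: `(realPart w) i = Re (w i)`. [folklore] -/
@[simp]
theorem realPart_apply (w : EuclideanSpace ℂ ι) (i : ι) : realPart w i = (w i).re := rfl

/-- `realPart (complexify v) = v`. [folklore] -/
@[simp]
theorem realPart_complexify (v : EuclideanSpace ℝ ι) : realPart (complexify v) = v := by
  ext i; simp

/-- Conjugation preserves the norm. [folklore] -/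
@[simp]
theorem norm_conjVec (w : EuclideanSpace ℂ ι) : ‖conjVec w‖ = ‖w‖ := by
  simp [EuclideanSpace.norm_eq]

/-- Coordinatewise complex conjugation on `ℂ^ι` as a continuous `ℝ`-linear map (an isometry).
[folklore] -/
def conjVecL : EuclideanSpace ℂ ι →L[ℝ] EuclideanSpace ℂ ι :=
  LinearMap.mkContinuous
    { toFun := conjVec
      map_add' := conjVec_add
      map_smul' := fun a w => by
        change conjVec ((a : ℂ) • w) = (a : ℂ) • conjVec w
        rw [conjVec_smul, Complex.conj_ofReal] }
    1 fun w => by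
      change ‖conjVec w‖ ≤ 1 * ‖w‖
      rw [one_mul, norm_conjVec]

/-- The bundled conjugation acts as `conjVec`. [folklore] -/
@[simp]
theorem conjVecL_apply (w : EuclideanSpace ℂ ι) : conjVecL w = conjVec w := rfl

/-- Complexified real vectors are conjugation-invariant. [folklore] -/
@[simp]
theorem conjVec_complexify (v : EuclideanSpace ℝ ι) : conjVec (complexify v) = complexify v := by
  ext i; simp

/-- The real part forgets the conjugation: `realPart (conjVec w) = realPart w`. [folklore] -/
@[simp]
theorem realPart_conjVec (w : EuclideanSpace ℂ ι) : realPart (conjVec w) = realPart w := by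
  ext i; simp

/-- **Reality criterion**: `complexify (realPart w) = w` iff `w` is conjugation-invariant. [folklore] -/
theorem complexify_realPart_eq_iff (w : EuclideanSpace ℂ ι) :
    complexify (realPart w) = w ↔ conjVec w = w := by
  constructor
  · intro h
    rw [← h, conjVec_complexify]
  · intro h
    ext i
    have hi : starRingEnd ℂ (w i) = w i := by simpa using congrArg (fun z => z i) h
    have him : (w i).im = 0 := by simpa using Complex.conj_eq_iff_im.1 hi
    simp [Complex.ext_iff, him]

/-- For conjugation-invariant `w`, `complexify (realPart w) = w`. [folklore] -/
theorem complexify_realPart {w : EuclideanSpace ℂ ι} (h : conjVec w = w) :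
    complexify (realPart w) = w :=
  (complexify_realPart_eq_iff w).2 h

/-- The complex inner product with a complexified real vector has real part the real pairing of
real parts: `Re ⟪w, complexify v⟫_ℂ = ⟪realPart w, v⟫_ℝ`. [folklore] -/
theorem re_inner_complexify_right (w : EuclideanSpace ℂ ι) (v : EuclideanSpace ℝ ι) :
    (inner ℂ w (complexify v)).re = inner ℝ (realPart w) v := by
  simp only [PiLp.inner_apply, complexify_apply, RCLike.inner_apply, Complex.re_sum,
    realPart_apply, conj_trivial]
  refine Finset.sum_congr rfl fun i _ => ?_
  simp [Complex.mul_re, mul_comm]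

end EuclideanSpace

namespace Torus

variable {d : Type*} [Fintype d]

/-! ## Frequency balls -/

section FreqBall

variable [DecidableEq d]

/-- The **frequency ball** of radius `N`: all `k ∈ ℤ^d` with `|k|² ≤ N²` (mean mode `k = 0`
included). Carved out of the box `[-N, N]^d` only as a finiteness device — the box condition is
implied by `|k|² ≤ N²` (`mem_freqBall`). These index the plain Fourier truncations
`Torus.fourierTruncate` (mean mode kept, no Leray projection); on weakly divergence-free
mean-zero fields these agree with the Galerkin projections `P_n` onto the span of the first Stokes
eigenfunctions of Robinson–Rodrigo–Sadowski 2016, §4.1, (4.1), p. 71 (Constantin–Foias 1988,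
Ch. 8, (8.3)). [cite: RobinsonRodrigoSadowski2016, §4.1 (4.1)] -/
def freqBall (N : ℕ) : Finset (d → ℤ) :=
  (Fintype.piFinset fun _ : d => Finset.Icc (-(N : ℤ)) N).filter fun k => freqNormSq k ≤ (N : ℝ) ^ 2

/-- Membership in the frequency ball: `k ∈ freqBall N ↔ |k|² ≤ N²`. [folklore] -/
theorem mem_freqBall {N : ℕ} {k : d → ℤ} : k ∈ freqBall N ↔ freqNormSq k ≤ (N : ℝ) ^ 2 := by
  simp only [freqBall, Finset.mem_filter, Fintype.mem_piFinset, Finset.mem_Icc, and_iff_right_iff_imp]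
  intro h i
  have hi : ((k i : ℝ)) ^ 2 ≤ (N : ℝ) ^ 2 :=
    (Finset.single_le_sum (f := fun j => ((k j : ℝ)) ^ 2) (fun _ _ => sq_nonneg _)
      (Finset.mem_univ i)).trans h
  have habs : -(N : ℝ) ≤ (k i : ℝ) ∧ (k i : ℝ) ≤ N := abs_le_of_sq_le_sq' hi (Nat.cast_nonneg N)
  exact ⟨by exact_mod_cast habs.1, by exact_mod_cast habs.2⟩

/-- Frequencies outside the ball: `k ∉ freqBall N ↔ N² < |k|²`. [folklore] -/
theorem not_mem_freqBall {N : ℕ} {k : d → ℤ} : k ∉ freqBall N ↔ (N : ℝ) ^ 2 < freqNormSq k := by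
  rw [mem_freqBall, not_le]

/-- The frequency ball is symmetric: `-k ∈ freqBall N ↔ k ∈ freqBall N`. [folklore] -/
@[simp]
theorem neg_mem_freqBall {N : ℕ} {k : d → ℤ} : -k ∈ freqBall N ↔ k ∈ freqBall N := by
  rw [mem_freqBall, mem_freqBall, freqNormSq_neg]

/-- The zero frequency lies in every ball. [folklore] -/
theorem zero_mem_freqBall (N : ℕ) : (0 : d → ℤ) ∈ freqBall N := by
  rw [mem_freqBall, freqNormSq_zero]; positivity

/-- The balls increase with the radius. [folklore] -/
theorem freqBall_mono {N M : ℕ} (h : N ≤ M) : (freqBall N : Finset (d → ℤ)) ⊆ freqBall M := by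
  intro k hk
  rw [mem_freqBall] at hk ⊢
  exact hk.trans (by gcongr)

/-- `freqBall` is monotone. [folklore] -/
theorem monotone_freqBall : Monotone (freqBall (d := d)) := fun _ _ h => freqBall_mono h

/-- Every frequency lies in some ball (`|k|² ≤ N²` for `N ≥ |k|²`, say). [folklore] -/
theorem exists_mem_freqBall (k : d → ℤ) : ∃ N : ℕ, k ∈ freqBall N := by
  obtain ⟨N, hN⟩ := exists_nat_ge (freqNormSq k)
  refine ⟨N + 1, mem_freqBall.2 (hN.trans ?_)⟩
  have h1 : (1 : ℝ) ≤ (N + 1 : ℕ) := by exact_mod_cast Nat.le_add_left 1 N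
  have h2 : (N : ℝ) ≤ (N + 1 : ℕ) := by exact_mod_cast Nat.le_succ N
  nlinarith

/-- The balls exhaust `ℤ^d`: `freqBall N → ⊤` in the order of finite sets, i.e. every finite set
of frequencies is eventually contained in `freqBall N`. [folklore] -/
theorem tendsto_freqBall_atTop : Tendsto (freqBall (d := d)) atTop atTop := by
  refine Monotone.tendsto_atTop_atTop monotone_freqBall fun s => ?_
  classical
  choose N hN using fun k : d → ℤ => exists_mem_freqBall k
  refine ⟨s.sup N, fun k hk => freqBall_mono (Finset.le_sup hk) (hN k)⟩

end FreqBall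

/-! ## Orthonormality of the characters for the global volume -/

section Orthogonality

/-- **Orthonormality of the characters**, integral form for H21's global `volume`:
`∫_{T^d} e_{-m} e_n = δ_{mn}` (Grafakos 2014, (3.1.5); Mathlib `orthonormal_mFourier` for the local
Haar volume, transported along `Torus.volume_eq_pi_haarAddCircle`). [cite: Grafakos2014, §3.1.1] -/
theorem integral_mFourier_neg_mul_mFourier (m n : d → ℤ) :
    ∫ x, mFourier (-m) x * mFourier n x = if m = n then (1 : ℂ) else 0 := by
  have h : (∫ x, mFourier n x * starRingEnd ℂ (mFourier m x)
      ∂(Measure.pi fun _ : d => AddCircle.haarAddCircle)) = if m = n then (1 : ℂ) else 0 := by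
    have := orthonormal_iff_ite.1 (orthonormal_mFourier (d := d)) m n
    rwa [ContinuousMap.inner_toLp] at this
  rw [volume_eq_pi_haarAddCircle, ← h]
  refine integral_congr_ae (ae_of_all _ fun x => ?_)
  dsimp only
  rw [mFourier_neg, mul_comm]

/-- `∫_{T^d} e_n = δ_{n0}` for the global `volume`. [cite: Grafakos2014, §3.1.1] -/
theorem integral_mFourier (n : d → ℤ) : ∫ x, mFourier n x = if n = 0 then (1 : ℂ) else 0 := by
  have h := integral_mFourier_neg_mul_mFourier (d := d) 0 n
  simp only [neg_zero, mFourier_zero, ContinuousMap.one_apply, one_mul] at h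
  rw [h]
  by_cases hn : n = 0
  · simp [hn]
  · simp [hn, Ne.symm hn]

/-- Products of characters: `e_{-m}(x) e_n(x) = e_{n-m}(x)`. [folklore] -/
theorem mFourier_neg_mul (m n : d → ℤ) (x : UnitAddTorus d) :
    mFourier (-m) x * mFourier n x = mFourier (n - m) x := by
  rw [← mFourier_add, neg_add_eq_sub]

end Orthogonality

/-! ## Vector trigonometric polynomials -/

section TrigPoly

variable {V : Type*} [NormedAddCommGroup V] [NormedSpace ℂ V]

/-- The **vector trigonometric polynomial** with coefficient family `c : ℤ^d → V` over the finite
frequency set `S`: `trigPoly S c x = ∑_{k ∈ S} e_k(x) • c k` (only the values of `c` on `S`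
matter). For `S = freqBall N` and `V = ℂ^d` these are the Galerkin ansatz functions
(Robinson–Rodrigo–Sadowski 2016, §4.1; Constantin–Foias 1988, (8.3)). [cite: RobinsonRodrigoSadowski2016, §4.1] -/
def trigPoly (S : Finset (d → ℤ)) (c : (d → ℤ) → V) : UnitAddTorus d → V :=
  fun x => ∑ k ∈ S, mFourier k x • c k

/-- Unfolding `trigPoly`. [folklore] -/
theorem trigPoly_apply (S : Finset (d → ℤ)) (c : (d → ℤ) → V) (x : UnitAddTorus d) :
    trigPoly S c x = ∑ k ∈ S, mFourier k x • c k := rfl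

/-- `trigPoly` depends only on the coefficients on `S`. [folklore] -/
theorem trigPoly_congr {S : Finset (d → ℤ)} {c c' : (d → ℤ) → V} (h : ∀ k ∈ S, c k = c' k) :
    trigPoly S c = trigPoly S c' := by
  funext x
  exact Finset.sum_congr rfl fun k hk => by rw [h k hk]

/-- Enlarging `S` by frequencies where `c` vanishes does not change `trigPoly`. [folklore] -/
theorem trigPoly_subset {S S' : Finset (d → ℤ)} (hSS' : S ⊆ S') {c : (d → ℤ) → V}
    (h : ∀ k ∈ S', k ∉ S → c k = 0) : trigPoly S' c = trigPoly S c := by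
  funext x
  simp only [trigPoly_apply]
  refine (Finset.sum_subset hSS' fun k hk hkS => ?_).symm
  rw [h k hk hkS, smul_zero]

/-- `trigPoly` is additive in the coefficients. [folklore] -/
theorem trigPoly_add (S : Finset (d → ℤ)) (c c' : (d → ℤ) → V) :
    trigPoly S (c + c') = trigPoly S c + trigPoly S c' := by
  funext x
  simp [trigPoly_apply, smul_add, Finset.sum_add_distrib]

/-- `trigPoly` is homogeneous in the coefficients. [folklore] -/
theorem trigPoly_smul (S : Finset (d → ℤ)) (a : ℂ) (c : (d → ℤ) → V) :
    trigPoly S (a • c) = a • trigPoly S c := by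
  funext x
  simp [trigPoly_apply, smul_comm _ a, Finset.smul_sum]

/-- `trigPoly S 0 = 0`. [folklore] -/
@[simp]
theorem trigPoly_zero (S : Finset (d → ℤ)) : trigPoly S (0 : (d → ℤ) → V) = 0 := by
  funext x; simp [trigPoly_apply]

/-- `trigPoly` is subtractive in the coefficients. [folklore] -/
theorem trigPoly_sub (S : Finset (d → ℤ)) (c c' : (d → ℤ) → V) :
    trigPoly S (c - c') = trigPoly S c - trigPoly S c' := by
  funext x
  simp [trigPoly_apply, smul_sub, Finset.sum_sub_distrib]

/-- `trigPoly` on `S` as a sum of the coefficientwise pieces `x ↦ e_k(x) • c k`. [folklore] -/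
theorem trigPoly_eq_sum (S : Finset (d → ℤ)) (c : (d → ℤ) → V) :
    trigPoly S c = ∑ k ∈ S, fun x => mFourier k x • c k := by
  funext x; simp [trigPoly_apply, Finset.sum_apply]

/-- Each mode `x ↦ e_k(x) • v` is smooth. [folklore] -/
theorem isSmooth_mFourier_smul (k : d → ℤ) (v : V) :
    IsSmooth (fun x : UnitAddTorus d => mFourier k x • v) :=
  ContDiff.smul (isSmooth_mFourier k) contDiff_const

/-- Trigonometric polynomials are smooth. [folklore] -/
theorem isSmooth_trigPoly (S : Finset (d → ℤ)) (c : (d → ℤ) → V) : IsSmooth (trigPoly S c) := by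
  rw [trigPoly_eq_sum]
  unfold IsSmooth lift
  have : ((∑ k ∈ S, fun x => mFourier k x • c k) ∘ (proj : EuclideanSpace ℝ d → UnitAddTorus d)) =
      fun y => ∑ k ∈ S, mFourier k (proj y) • c k := by
    funext y; simp [Finset.sum_apply]
  rw [this]
  exact ContDiff.sum fun k _ => isSmooth_mFourier_smul k (c k)

/-- Trigonometric polynomials are continuous. [folklore] -/
theorem continuous_trigPoly (S : Finset (d → ℤ)) (c : (d → ℤ) → V) : Continuous (trigPoly S c) :=
  (isSmooth_trigPoly S c).continuous

/-- **Fourier coefficients of a trigonometric polynomial**: `𝓕(trigPoly S c)(k) = c k` for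
`k ∈ S` and `0` otherwise (orthonormality of the characters; Grafakos 2014, (3.1.5)). [cite: Grafakos2014, §3.1.1] -/
theorem mFourierCoeff_trigPoly [CompleteSpace V] (S : Finset (d → ℤ)) (c : (d → ℤ) → V)
    (k : d → ℤ) : mFourierCoeff (trigPoly S c) k = if k ∈ S then c k else 0 := by
  classical
  rw [mFourierCoeff_eq_integral_volume]
  simp only [trigPoly_apply, Finset.smul_sum, smul_smul]
  rw [integral_finsetSum S (f := fun m x => (mFourier (-k) x * mFourier m x) • c m) fun m _ =>
    (((mFourier (-k)).continuous.mul (mFourier m).continuous).smul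
      continuous_const).integrable_unitAddTorus]
  simp_rw [integral_smul_const, integral_mFourier_neg_mul_mFourier, ite_smul, one_smul, zero_smul]
  rw [Finset.sum_ite_eq]

/-- Along the coordinate line through `x` in direction `eⱼ`, the mode `e_m • v` has derivative
`(2πi mⱼ e_m(x)) • v` at the base point. [folklore] -/
theorem hasDerivAt_mFourier_smul_line [DecidableEq d] (m : d → ℤ) (v : V) (j : d)
    (x : UnitAddTorus d) :
    HasDerivAt (fun t : ℝ => mFourier m (x + proj (t • EuclideanSpace.single j (1 : ℝ))) • v)
      ((2 * Real.pi * Complex.I * (m j) * mFourier m x) • v) 0 := by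
  have h := (isSmooth_mFourier m).hasDerivAt_line_zero j x
  rw [partialDeriv_mFourier] at h
  exact h.smul_const v

/-- **Partial derivatives act diagonally on trigonometric polynomials**:
`∂ⱼ (∑ e_k • c k) = ∑ e_k • (2πi kⱼ c k)` (Grafakos 2014, proof of Prop. 3.2.6 (8)). [folklore] -/
theorem partialDeriv_trigPoly [DecidableEq d] (S : Finset (d → ℤ)) (c : (d → ℤ) → V) (j : d)
    (x : UnitAddTorus d) :
    partialDeriv j (trigPoly S c) x =
      trigPoly S (fun k => (2 * Real.pi * Complex.I * (k j)) • c k) x := by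
  have h : HasDerivAt
      (fun t : ℝ => ∑ k ∈ S, mFourier k (x + proj (t • EuclideanSpace.single j (1 : ℝ))) • c k)
      (∑ k ∈ S, (2 * Real.pi * Complex.I * (k j) * mFourier k x) • c k) 0 :=
    HasDerivAt.fun_sum fun k _ => hasDerivAt_mFourier_smul_line k (c k) j x
  rw [partialDeriv, Torus.lineDeriv]
  change deriv (fun t : ℝ => trigPoly S c (x + proj (t • EuclideanSpace.single j (1 : ℝ)))) 0 = _
  simp only [trigPoly_apply]
  rw [h.deriv]
  refine Finset.sum_congr rfl fun k _ => ?_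
  rw [smul_smul, mul_comm]

/-- Partial derivatives of trigonometric polynomials are trigonometric polynomials (function
form of `partialDeriv_trigPoly`). [folklore] -/
theorem partialDeriv_trigPoly' [DecidableEq d] (S : Finset (d → ℤ)) (c : (d → ℤ) → V) (j : d) :
    partialDeriv j (trigPoly S c) = trigPoly S (fun k => (2 * Real.pi * Complex.I * (k j)) • c k) :=
  funext (partialDeriv_trigPoly S c j)

end TrigPoly

/-! ## Finite Parseval identity for trigonometric polynomials with Hilbert values -/

section Parseval

variable {V : Type*} [NormedAddCommGroup V] [InnerProductSpace ℂ V]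

/-- **Finite Parseval identity**: for coefficient families `c`, `c'` and a finite `S`,
`∫ ⟪trigPoly S c, trigPoly S c'⟫_ℂ = ∑_{k ∈ S} ⟪c k, c' k⟫_ℂ` (expand and use orthonormality;
Grafakos 2014, Prop. 3.2.7 (3) for finite sums). [cite: Grafakos2014, Prop. 3.2.7 (3)] -/
theorem integral_inner_trigPoly (S : Finset (d → ℤ)) (c c' : (d → ℤ) → V) :
    ∫ x, inner ℂ (trigPoly S c x) (trigPoly S c' x) = ∑ k ∈ S, inner ℂ (c k) (c' k) := by
  classical
  have hpt : ∀ x, inner ℂ (trigPoly S c x) (trigPoly S c' x) =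
      ∑ m ∈ S, ∑ n ∈ S, mFourier (-m) x * mFourier n x * inner ℂ (c m) (c' n) := by
    intro x
    simp only [trigPoly_apply, sum_inner, inner_sum, inner_smul_left, inner_smul_right,
      ← mFourier_neg, Finset.mul_sum]
    rw [Finset.sum_comm]
    refine Finset.sum_congr rfl fun m _ => Finset.sum_congr rfl fun n _ => ?_
    ring
  simp_rw [hpt]
  have hint : ∀ m n : d → ℤ, Integrable
      (fun x : UnitAddTorus d => mFourier (-m) x * mFourier n x * inner ℂ (c m) (c' n)) volume :=
    fun m n => (((mFourier (-m)).continuous.mul (mFourier n).continuous).mul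
      continuous_const).integrable_unitAddTorus
  rw [integral_finsetSum S (f := fun m x => ∑ n ∈ S, mFourier (-m) x * mFourier n x * inner ℂ (c m) (c' n))
    fun m _ => integrable_finsetSum S fun n _ => hint m n]
  refine Finset.sum_congr rfl fun m hm => ?_
  rw [integral_finsetSum S (f := fun n x => mFourier (-m) x * mFourier n x * inner ℂ (c m) (c' n))
    fun n _ => hint m n]
  simp_rw [integral_mul_const, integral_mFourier_neg_mul_mFourier, ite_mul, one_mul, zero_mul]
  rw [Finset.sum_ite_eq, if_pos hm]

/-- **Finite Parseval identity for norms**: `∫ ‖trigPoly S c‖² = ∑_{k ∈ S} ‖c k‖²`. [cite: Grafakos2014, Prop. 3.2.7 (3)] -/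
theorem integral_norm_sq_trigPoly (S : Finset (d → ℤ)) (c : (d → ℤ) → V) :
    ∫ x, ‖trigPoly S c x‖ ^ 2 = ∑ k ∈ S, ‖c k‖ ^ 2 := by
  have h := integral_inner_trigPoly S c c
  have h1 : ∀ x, inner ℂ (trigPoly S c x) (trigPoly S c x) = ((‖trigPoly S c x‖ ^ 2 : ℝ) : ℂ) :=
    fun x => by rw [inner_self_eq_norm_sq_to_K]; norm_cast
  have h2 : ∀ k, inner ℂ (c k) (c k) = ((‖c k‖ ^ 2 : ℝ) : ℂ) := fun k => by
    rw [inner_self_eq_norm_sq_to_K]; norm_cast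
  simp_rw [h1, h2] at h
  rw [integral_complex_ofReal, ← Complex.ofReal_sum] at h
  exact_mod_cast h

end Parseval

/-! ## Real vector trigonometric polynomials -/

section Real

/-- **Conjugate symmetry** of a coefficient family `c : ℤ^d → ℂ^d`: `c (-k) = conj (c k)` for all
`k` — the reality condition on Fourier coefficients (Grafakos 2014, Prop. 3.2.6 (4)). [folklore] -/
def IsConjSymm (c : (d → ℤ) → EuclideanSpace ℂ d) : Prop :=
  ∀ k, c (-k) = EuclideanSpace.conjVec (c k)

omit [Fintype d] in
/-- The zero family is conjugate symmetric. [folklore] -/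
theorem isConjSymm_zero : IsConjSymm (0 : (d → ℤ) → EuclideanSpace ℂ d) := fun k => by simp

omit [Fintype d] in
/-- Conjugate symmetry is preserved by sums. [folklore] -/
theorem IsConjSymm.add {c c' : (d → ℤ) → EuclideanSpace ℂ d} (hc : IsConjSymm c)
    (hc' : IsConjSymm c') : IsConjSymm (c + c') := fun k => by
  simp [hc k, hc' k, EuclideanSpace.conjVec_add]

omit [Fintype d] in
/-- Conjugate symmetry is preserved by negation. [folklore] -/
theorem IsConjSymm.neg {c : (d → ℤ) → EuclideanSpace ℂ d} (hc : IsConjSymm c) : IsConjSymm (-c) :=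
  fun k => by
  have h : EuclideanSpace.conjVec (-c k) = -EuclideanSpace.conjVec (c k) := by
    ext i; simp
  simp [hc k, h]

omit [Fintype d] in
/-- Conjugate symmetry is preserved by differences. [folklore] -/
theorem IsConjSymm.sub {c c' : (d → ℤ) → EuclideanSpace ℂ d} (hc : IsConjSymm c)
    (hc' : IsConjSymm c') : IsConjSymm (c - c') := by
  rw [sub_eq_add_neg]; exact hc.add hc'.neg

omit [Fintype d] in
/-- Conjugate symmetry is preserved by real scalar multiplication. [folklore] -/
theorem IsConjSymm.real_smul {c : (d → ℤ) → EuclideanSpace ℂ d} (hc : IsConjSymm c) (a : ℝ) :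
    IsConjSymm (a • c) := fun k => by
  have h : EuclideanSpace.conjVec ((a : ℂ) • c k) = (a : ℂ) • EuclideanSpace.conjVec (c k) := by
    rw [EuclideanSpace.conjVec_smul, Complex.conj_ofReal]
  simp only [Pi.smul_apply, hc k]
  rw [← Complex.coe_smul, ← Complex.coe_smul, h]

/-- Restricting a conjugate-symmetric family to a symmetric frequency set (zero outside) keeps
it conjugate symmetric. [folklore] -/
theorem IsConjSymm.indicator {c : (d → ℤ) → EuclideanSpace ℂ d} (hc : IsConjSymm c)
    {S : Finset (d → ℤ)} (hS : ∀ k ∈ S, -k ∈ S) :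
    IsConjSymm (fun k => if k ∈ S then c k else 0) := by
  intro k
  dsimp only
  have hiff : -k ∈ S ↔ k ∈ S := ⟨fun h => by simpa using hS _ h, fun h => hS _ h⟩
  by_cases hk : k ∈ S
  · rw [if_pos (hiff.2 hk), if_pos hk, hc k]
  · rw [if_neg (mt hiff.1 hk), if_neg hk, EuclideanSpace.conjVec_zero]

omit [Fintype d] in
/-- The derivative symbol preserves conjugate symmetry: `k ↦ (2πi kⱼ) • c k` is conjugate
symmetric if `c` is. [folklore] -/
theorem IsConjSymm.deriv {c : (d → ℤ) → EuclideanSpace ℂ d} (hc : IsConjSymm c) (j : d) :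
    IsConjSymm (fun k : d → ℤ => (2 * Real.pi * Complex.I * (k j)) • c k) := by
  intro k
  dsimp only
  rw [hc k, EuclideanSpace.conjVec_smul]
  congr 1
  simp only [Pi.neg_apply, Int.cast_neg, map_mul, Complex.conj_ofNat, Complex.conj_ofReal,
    Complex.conj_I, map_intCast]
  ring

/-- **Fourier coefficients of complexified real integrable fields are conjugate symmetric**
(Grafakos 2014, Prop. 3.2.6 (4); `Torus.mFourierCoeff_complexify_neg_apply`). [folklore] -/
theorem isConjSymm_mFourierCoeff {u : UnitAddTorus d → EuclideanSpace ℝ d}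
    (hu : Integrable u volume) :
    IsConjSymm (fun k => mFourierCoeff (EuclideanSpace.complexify ∘ u) k) := by
  intro k
  ext i
  rw [mFourierCoeff_complexify_neg_apply hu, EuclideanSpace.conjVec_apply]

/-- The **real vector trigonometric polynomial** with coefficients `c` over `S`:
`realTrigPoly S c = Re ∘ trigPoly S c : T^d → ℝ^d`. For conjugate-symmetric `c` on a symmetric
`S` no information is lost (`complexify_realTrigPoly`): these are the real Galerkin fields
`∑_{|k| ≤ N} û_k e^{2πi k·x}`, `û_{-k} = conj û_k` (Robinson–Rodrigo–Sadowski 2016, §4.1 and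
§1.5 (1.10), p. 27; Constantin–Foias 1988, (8.3)). [cite: RobinsonRodrigoSadowski2016, §4.1] -/
def realTrigPoly (S : Finset (d → ℤ)) (c : (d → ℤ) → EuclideanSpace ℂ d) :
    UnitAddTorus d → EuclideanSpace ℝ d :=
  fun x => EuclideanSpace.realPart (trigPoly S c x)

/-- Unfolding `realTrigPoly`. [folklore] -/
theorem realTrigPoly_apply (S : Finset (d → ℤ)) (c : (d → ℤ) → EuclideanSpace ℂ d)
    (x : UnitAddTorus d) : realTrigPoly S c x = EuclideanSpace.realPart (trigPoly S c x) := rfl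

/-- `realTrigPoly S c = realPart ∘ trigPoly S c`. [folklore] -/
theorem realTrigPoly_eq_comp (S : Finset (d → ℤ)) (c : (d → ℤ) → EuclideanSpace ℂ d) :
    realTrigPoly S c = EuclideanSpace.realPart ∘ trigPoly S c := rfl

/-- `realTrigPoly` depends only on the coefficients on `S`. [folklore] -/
theorem realTrigPoly_congr {S : Finset (d → ℤ)} {c c' : (d → ℤ) → EuclideanSpace ℂ d}
    (h : ∀ k ∈ S, c k = c' k) : realTrigPoly S c = realTrigPoly S c' := by
  rw [realTrigPoly_eq_comp, realTrigPoly_eq_comp, trigPoly_congr h]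

/-- `realTrigPoly` is additive in the coefficients. [folklore] -/
theorem realTrigPoly_add (S : Finset (d → ℤ)) (c c' : (d → ℤ) → EuclideanSpace ℂ d) :
    realTrigPoly S (c + c') = realTrigPoly S c + realTrigPoly S c' := by
  funext x; simp [realTrigPoly_apply, trigPoly_add]

/-- `realTrigPoly` is subtractive in the coefficients. [folklore] -/
theorem realTrigPoly_sub (S : Finset (d → ℤ)) (c c' : (d → ℤ) → EuclideanSpace ℂ d) :
    realTrigPoly S (c - c') = realTrigPoly S c - realTrigPoly S c' := by
  funext x; simp [realTrigPoly_apply, trigPoly_sub]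

/-- `realTrigPoly S 0 = 0`. [folklore] -/
@[simp]
theorem realTrigPoly_zero (S : Finset (d → ℤ)) :
    realTrigPoly S (0 : (d → ℤ) → EuclideanSpace ℂ d) = 0 := by
  funext x; simp [realTrigPoly_apply]

/-- Real trigonometric polynomials are smooth. [folklore] -/
theorem isSmooth_realTrigPoly (S : Finset (d → ℤ)) (c : (d → ℤ) → EuclideanSpace ℂ d) :
    IsSmooth (realTrigPoly S c) := by
  rw [realTrigPoly_eq_comp]
  exact IsSmooth.comp_clm EuclideanSpace.realPart (isSmooth_trigPoly S c)

/-- Real trigonometric polynomials are continuous. [folklore] -/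
theorem continuous_realTrigPoly (S : Finset (d → ℤ)) (c : (d → ℤ) → EuclideanSpace ℂ d) :
    Continuous (realTrigPoly S c) :=
  (isSmooth_realTrigPoly S c).continuous

/-- Real trigonometric polynomials are in every `L^p`. [folklore] -/
theorem memLp_realTrigPoly (S : Finset (d → ℤ)) (c : (d → ℤ) → EuclideanSpace ℂ d) (p : ℝ≥0∞) :
    MemLp (realTrigPoly S c) p volume :=
  (isSmooth_realTrigPoly S c).memLp p

/-- On a symmetric frequency set, a trigonometric polynomial with conjugate-symmetric
coefficients takes conjugation-invariant (i.e. real) values. [folklore] -/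
theorem conjVec_trigPoly_apply {S : Finset (d → ℤ)} (hS : ∀ k ∈ S, -k ∈ S)
    {c : (d → ℤ) → EuclideanSpace ℂ d} (hc : IsConjSymm c) (x : UnitAddTorus d) :
    EuclideanSpace.conjVec (trigPoly S c x) = trigPoly S c x := by
  have hc' : ∀ k, EuclideanSpace.conjVec (c k) = c (-k) := fun k => (hc k).symm
  rw [trigPoly_apply, EuclideanSpace.conjVec_sum]
  simp_rw [EuclideanSpace.conjVec_smul, ← mFourier_neg, hc']
  exact Finset.sum_nbij' (fun k => -k) (fun k => -k) hS hS (fun k _ => neg_neg k)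
    (fun k _ => neg_neg k) fun k _ => rfl

/-- **No information is lost in the real form**: for conjugate-symmetric coefficients on a
symmetric `S`, `complexify (realTrigPoly S c x) = trigPoly S c x`. [folklore] -/
theorem complexify_realTrigPoly {S : Finset (d → ℤ)} (hS : ∀ k ∈ S, -k ∈ S)
    {c : (d → ℤ) → EuclideanSpace ℂ d} (hc : IsConjSymm c) (x : UnitAddTorus d) :
    EuclideanSpace.complexify (realTrigPoly S c x) = trigPoly S c x :=
  EuclideanSpace.complexify_realPart (conjVec_trigPoly_apply hS hc x)

/-- Function form of `complexify_realTrigPoly`. [folklore] -/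
theorem complexify_comp_realTrigPoly {S : Finset (d → ℤ)} (hS : ∀ k ∈ S, -k ∈ S)
    {c : (d → ℤ) → EuclideanSpace ℂ d} (hc : IsConjSymm c) :
    EuclideanSpace.complexify ∘ realTrigPoly S c = trigPoly S c :=
  funext (complexify_realTrigPoly hS hc)

/-- Pointwise norms: `‖realTrigPoly S c x‖ = ‖trigPoly S c x‖` (conjugate-symmetric `c`,
symmetric `S`). [folklore] -/
theorem norm_realTrigPoly_apply {S : Finset (d → ℤ)} (hS : ∀ k ∈ S, -k ∈ S)
    {c : (d → ℤ) → EuclideanSpace ℂ d} (hc : IsConjSymm c) (x : UnitAddTorus d) :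
    ‖realTrigPoly S c x‖ = ‖trigPoly S c x‖ := by
  rw [← complexify_realTrigPoly hS hc x, EuclideanSpace.norm_complexify]

/-- **Fourier coefficients of a real trigonometric polynomial** (conjugate-symmetric `c`,
symmetric `S`): `𝓕(complexify ∘ realTrigPoly S c)(k) = c k` on `S`, `0` off `S`. [cite: Grafakos2014, §3.1.1] -/
theorem mFourierCoeff_realTrigPoly {S : Finset (d → ℤ)} (hS : ∀ k ∈ S, -k ∈ S)
    {c : (d → ℤ) → EuclideanSpace ℂ d} (hc : IsConjSymm c) (k : d → ℤ) :
    mFourierCoeff (EuclideanSpace.complexify ∘ realTrigPoly S c) k = if k ∈ S then c k else 0 := by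
  rw [complexify_comp_realTrigPoly hS hc, mFourierCoeff_trigPoly]

/-- Off `S`, the Fourier coefficients of `realTrigPoly S c` vanish. [folklore] -/
theorem mFourierCoeff_realTrigPoly_eq_zero {S : Finset (d → ℤ)} (hS : ∀ k ∈ S, -k ∈ S)
    {c : (d → ℤ) → EuclideanSpace ℂ d} (hc : IsConjSymm c) {k : d → ℤ} (hk : k ∉ S) :
    mFourierCoeff (EuclideanSpace.complexify ∘ realTrigPoly S c) k = 0 := by
  rw [mFourierCoeff_realTrigPoly hS hc, if_neg hk]

/-- **Finite Parseval for real trigonometric polynomials**: `∫ ‖realTrigPoly S c‖² = ∑_{k∈S} ‖c k‖²`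
(conjugate-symmetric `c`, symmetric `S`; Grafakos 2014, Prop. 3.2.7 (3)). [cite: Grafakos2014, Prop. 3.2.7 (3)] -/
theorem integral_norm_sq_realTrigPoly {S : Finset (d → ℤ)} (hS : ∀ k ∈ S, -k ∈ S)
    {c : (d → ℤ) → EuclideanSpace ℂ d} (hc : IsConjSymm c) :
    ∫ x, ‖realTrigPoly S c x‖ ^ 2 = ∑ k ∈ S, ‖c k‖ ^ 2 := by
  simp_rw [norm_realTrigPoly_apply hS hc]
  exact integral_norm_sq_trigPoly S c

/-- Kinetic energy of a real trigonometric polynomial: `E = ½ ∑_{k∈S} ‖c k‖²`. [folklore] -/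
theorem kineticEnergy_realTrigPoly {S : Finset (d → ℤ)} (hS : ∀ k ∈ S, -k ∈ S)
    {c : (d → ℤ) → EuclideanSpace ℂ d} (hc : IsConjSymm c) :
    kineticEnergy (realTrigPoly S c) = 2⁻¹ * ∑ k ∈ S, ‖c k‖ ^ 2 := by
  rw [kineticEnergy, integral_norm_sq_realTrigPoly hS hc]

/-- **Inner products of a real trigonometric polynomial with an `L²` field** reduce to finitely
many Fourier coefficients: `∫ ⟪realTrigPoly S c, w⟫ = ∑_{k∈S} Re ⟪c k, ŵ(k)⟫_ℂ`,
`ŵ = 𝓕(complexify ∘ w)` (Parseval, `Torus.hasSum_re_inner_mFourierCoeff_complexify`).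
[cite: Grafakos2014, Prop. 3.2.7 (3)] -/
theorem integral_inner_realTrigPoly_left {S : Finset (d → ℤ)} (hS : ∀ k ∈ S, -k ∈ S)
    {c : (d → ℤ) → EuclideanSpace ℂ d} (hc : IsConjSymm c)
    {w : UnitAddTorus d → EuclideanSpace ℝ d} (hw : MemLp w 2 volume) :
    ∫ x, ⟪realTrigPoly S c x, w x⟫_ℝ =
      ∑ k ∈ S, (inner ℂ (c k) (mFourierCoeff (EuclideanSpace.complexify ∘ w) k)).re := by
  have h := hasSum_re_inner_mFourierCoeff_complexify (memLp_realTrigPoly S c 2) hw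
  simp_rw [mFourierCoeff_realTrigPoly hS hc] at h
  have h' : HasSum (fun k : d → ℤ => (inner ℂ (if k ∈ S then c k else 0)
      (mFourierCoeff (EuclideanSpace.complexify ∘ w) k)).re)
      (∑ k ∈ S, (inner ℂ (if k ∈ S then c k else 0)
        (mFourierCoeff (EuclideanSpace.complexify ∘ w) k)).re) :=
    hasSum_sum_of_ne_finset_zero fun k hk => by simp [hk]
  rw [h.unique h']
  exact Finset.sum_congr rfl fun k hk => by rw [if_pos hk]

/-- The same with the trigonometric polynomial on the right:
`∫ ⟪w, realTrigPoly S c⟫ = ∑_{k∈S} Re ⟪ŵ(k), c k⟫_ℂ`. [folklore] -/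
theorem integral_inner_realTrigPoly_right {S : Finset (d → ℤ)} (hS : ∀ k ∈ S, -k ∈ S)
    {c : (d → ℤ) → EuclideanSpace ℂ d} (hc : IsConjSymm c)
    {w : UnitAddTorus d → EuclideanSpace ℝ d} (hw : MemLp w 2 volume) :
    ∫ x, ⟪w x, realTrigPoly S c x⟫_ℝ =
      ∑ k ∈ S, (inner ℂ (mFourierCoeff (EuclideanSpace.complexify ∘ w) k) (c k)).re := by
  have hsym : ∀ x, ⟪w x, realTrigPoly S c x⟫_ℝ = ⟪realTrigPoly S c x, w x⟫_ℝ := fun x => by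
    rw [real_inner_comm]
  simp_rw [hsym]
  rw [integral_inner_realTrigPoly_left hS hc hw]
  refine Finset.sum_congr rfl fun k _ => ?_
  rw [← inner_conj_symm, Complex.conj_re]

/-- Inner product of two real trigonometric polynomials on the same symmetric `S`:
`∫ ⟪realTrigPoly S c, realTrigPoly S c'⟫ = ∑_{k∈S} Re ⟪c k, c' k⟫_ℂ`. [folklore] -/
theorem integral_inner_realTrigPoly_realTrigPoly {S : Finset (d → ℤ)} (hS : ∀ k ∈ S, -k ∈ S)
    {c c' : (d → ℤ) → EuclideanSpace ℂ d} (hc : IsConjSymm c) (hc' : IsConjSymm c') :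
    ∫ x, ⟪realTrigPoly S c x, realTrigPoly S c' x⟫_ℝ = ∑ k ∈ S, (inner ℂ (c k) (c' k)).re := by
  rw [integral_inner_realTrigPoly_left hS hc (memLp_realTrigPoly S c' 2)]
  refine Finset.sum_congr rfl fun k hk => ?_
  rw [mFourierCoeff_realTrigPoly hS hc', if_pos hk]

/-! ### Derivatives, divergence, gradient norm -/

/-- **Partial derivatives of real trigonometric polynomials**:
`∂ⱼ realTrigPoly S c = realTrigPoly S (k ↦ (2πi kⱼ) • c k)` (the real part is a continuous
linear map and commutes with `∂ⱼ`, `Torus.partialDeriv_clm_comp`). [folklore] -/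
theorem partialDeriv_realTrigPoly [DecidableEq d] (S : Finset (d → ℤ))
    (c : (d → ℤ) → EuclideanSpace ℂ d) (j : d) (x : UnitAddTorus d) :
    partialDeriv j (realTrigPoly S c) x =
      realTrigPoly S (fun k => (2 * Real.pi * Complex.I * (k j)) • c k) x := by
  rw [realTrigPoly_eq_comp, partialDeriv_clm_comp (isSmooth_trigPoly S c), partialDeriv_trigPoly]
  rfl

/-- Function form of `partialDeriv_realTrigPoly`. [folklore] -/
theorem partialDeriv_realTrigPoly' [DecidableEq d] (S : Finset (d → ℤ))
    (c : (d → ℤ) → EuclideanSpace ℂ d) (j : d) :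
    partialDeriv j (realTrigPoly S c) =
      realTrigPoly S (fun k => (2 * Real.pi * Complex.I * (k j)) • c k) :=
  funext (partialDeriv_realTrigPoly S c j)

/-- **Transversality** of a coefficient family on `S`: `k · c k = ∑ⱼ kⱼ (c k)ⱼ = 0` for `k ∈ S` —
the Fourier-side incompressibility condition `k · û_k = 0` (Robinson–Rodrigo–Sadowski 2016, §2.1,
Def. 2.1, p. 42; Constantin–Foias 1988, Ch. 4, (4.13)). [cite: RobinsonRodrigoSadowski2016, Def. 2.1] -/
def IsTransversal (S : Finset (d → ℤ)) (c : (d → ℤ) → EuclideanSpace ℂ d) : Prop :=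
  ∀ k ∈ S, ∑ j, (k j : ℂ) * c k j = 0

/-- Coordinates of a real trigonometric polynomial: `(realTrigPoly S c x) i = Re ((trigPoly S c x) i)`. [folklore] -/
theorem realTrigPoly_apply_coord (S : Finset (d → ℤ)) (c : (d → ℤ) → EuclideanSpace ℂ d)
    (x : UnitAddTorus d) (i : d) : realTrigPoly S c x i = (trigPoly S c x i).re := rfl

/-- Coordinates of a trigonometric polynomial: `(trigPoly S c x) i = ∑_{k∈S} e_k(x) (c k)ᵢ`. [folklore] -/
theorem trigPoly_apply_coord (S : Finset (d → ℤ)) (c : (d → ℤ) → EuclideanSpace ℂ d)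
    (x : UnitAddTorus d) (i : d) : trigPoly S c x i = ∑ k ∈ S, mFourier k x * c k i := by
  simp [trigPoly_apply, WithLp.ofLp_sum, Finset.sum_apply]

/-- Partial derivatives of the coordinates of a real trigonometric polynomial:
`∂ⱼ (realTrigPoly S c)ᵢ (x) = Re ((trigPoly S ((2πi kⱼ) • c) x)ᵢ)`. [folklore] -/
theorem partialDeriv_realTrigPoly_coord [DecidableEq d] (S : Finset (d → ℤ))
    (c : (d → ℤ) → EuclideanSpace ℂ d) (j i : d) (x : UnitAddTorus d) :
    partialDeriv j (fun y => realTrigPoly S c y i) x =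
      (trigPoly S (fun k => (2 * Real.pi * Complex.I * (k j)) • c k) x i).re := by
  -- the coordinate function is `L ∘ trigPoly S c` with `L = Re ∘ projᵢ` real-linear
  have hcoord : (fun y => realTrigPoly S c y i) =
      ((Complex.reCLM.comp ((EuclideanSpace.proj i : EuclideanSpace ℂ d →L[ℂ] ℂ).restrictScalars ℝ))
        ∘ trigPoly S c) := rfl
  rw [hcoord, partialDeriv_clm_comp (isSmooth_trigPoly S c), partialDeriv_trigPoly]
  rfl

/-- **Divergence of a real trigonometric polynomial**:
`div (realTrigPoly S c)(x) = Re (∑_{k∈S} e_k(x) · 2πi (k · c k))`. [folklore] -/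
theorem divergence_realTrigPoly [DecidableEq d] (S : Finset (d → ℤ))
    (c : (d → ℤ) → EuclideanSpace ℂ d) (x : UnitAddTorus d) :
    divergence (realTrigPoly S c) x =
      (∑ k ∈ S, mFourier k x * (2 * Real.pi * Complex.I * ∑ j, (k j : ℂ) * c k j)).re := by
  unfold divergence
  simp_rw [partialDeriv_realTrigPoly_coord, trigPoly_apply_coord, ← Complex.re_sum]
  congr 1
  simp only [PiLp.smul_apply, smul_eq_mul, Finset.mul_sum]
  rw [Finset.sum_comm]
  refine Finset.sum_congr rfl fun k _ => Finset.sum_congr rfl fun j _ => ?_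
  ring

/-- **Transversal coefficients give divergence-free fields**: if `k · c k = 0` on `S` then
`realTrigPoly S c` is (classically) divergence free (`div (û_k e^{ik·x}) = i (k · û_k) e^{ik·x}`,
Robinson–Rodrigo–Sadowski 2016, §2.1, p. 42). [cite: RobinsonRodrigoSadowski2016, Def. 2.1] -/
theorem isDivFree_realTrigPoly [DecidableEq d] {S : Finset (d → ℤ)}
    {c : (d → ℤ) → EuclideanSpace ℂ d} (hT : IsTransversal S c) : IsDivFree (realTrigPoly S c) := by
  intro x
  rw [divergence_realTrigPoly]
  rw [Finset.sum_eq_zero fun k hk => by rw [hT k hk, mul_zero, mul_zero]]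
  simp

/-- **Spectral gradient norm of a real trigonometric polynomial**:
`eGradNormSq (realTrigPoly S c) = ofReal (4π² ∑_{k∈S} |k|² ‖c k‖²)` (conjugate-symmetric `c`,
symmetric `S`; the sum defining `Torus.eHomSobolevSeminorm 1` is finite). [folklore] -/
theorem eGradNormSq_realTrigPoly {S : Finset (d → ℤ)} (hS : ∀ k ∈ S, -k ∈ S)
    {c : (d → ℤ) → EuclideanSpace ℂ d} (hc : IsConjSymm c) :
    eGradNormSq (realTrigPoly S c) =
      ENNReal.ofReal (4 * Real.pi ^ 2 * ∑ k ∈ S, freqNormSq k * ‖c k‖ ^ 2) := by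
  rw [eGradNormSq, eHomSobolevSeminorm, ENNReal.rpow_half_sq]
  simp_rw [mFourierCoeff_realTrigPoly hS hc]
  rw [tsum_eq_sum (s := S) fun k hk => by simp [hk]]
  have hterm : ∀ k ∈ S, (if k = 0 then 0 else ENNReal.ofReal (freqNormSq k ^ (1 : ℝ))) *
      ‖(if k ∈ S then c k else 0)‖ₑ ^ 2 = ENNReal.ofReal (freqNormSq k * ‖c k‖ ^ 2) := by
    intro k hk
    rw [if_pos hk, Real.rpow_one, ENNReal.ofReal_mul (freqNormSq_nonneg k), ← ofReal_norm,
      ← ENNReal.ofReal_pow (norm_nonneg _)]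
    by_cases h0 : k = 0
    · subst h0; simp [freqNormSq_zero]
    · rw [if_neg h0]
  rw [Finset.sum_congr rfl hterm, ← ENNReal.ofReal_sum_of_nonneg fun k _ =>
      mul_nonneg (freqNormSq_nonneg k) (sq_nonneg _),
    ← ENNReal.ofReal_mul (by positivity : (0 : ℝ) ≤ 4 * Real.pi ^ 2)]

/-- The spectral gradient norm of a real trigonometric polynomial, real form. [folklore] -/
theorem toReal_eGradNormSq_realTrigPoly {S : Finset (d → ℤ)} (hS : ∀ k ∈ S, -k ∈ S)
    {c : (d → ℤ) → EuclideanSpace ℂ d} (hc : IsConjSymm c) :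
    (eGradNormSq (realTrigPoly S c)).toReal = 4 * Real.pi ^ 2 * ∑ k ∈ S, freqNormSq k * ‖c k‖ ^ 2 := by
  rw [eGradNormSq_realTrigPoly hS hc, ENNReal.toReal_ofReal]
  exact mul_nonneg (by positivity) (Finset.sum_nonneg fun k _ =>
    mul_nonneg (freqNormSq_nonneg k) (sq_nonneg _))

end Real


/-! ## Fourier coefficients: two small supplements -/

section Coeff

variable {F : Type*} [NormedAddCommGroup F] [NormedSpace ℂ F]

/-- The Fourier integrand `e_{-k} • f` of an integrable `f` is integrable (global volume). [folklore] -/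
theorem integrable_mFourier_smul' {f : UnitAddTorus d → F} (hf : Integrable f volume) (k : d → ℤ) :
    Integrable (fun x => mFourier (-k) x • f x) volume :=
  hf.bdd_smul 1 (mFourier (-k)).continuous.aestronglyMeasurable
    (Eventually.of_forall fun x => ((mFourier (-k)).norm_coe_le_norm x).trans_eq mFourier_norm)

/-- Fourier coefficients of a difference of integrable functions. [folklore] -/
theorem mFourierCoeff_sub {f g : UnitAddTorus d → F} (hf : Integrable f volume)
    (hg : Integrable g volume) (k : d → ℤ) :
    mFourierCoeff (f - g) k = mFourierCoeff f k - mFourierCoeff g k := by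
  simp only [mFourierCoeff_eq_integral_volume, Pi.sub_apply, smul_sub]
  exact integral_sub (integrable_mFourier_smul' hf k) (integrable_mFourier_smul' hg k)

omit [Fintype d] in
/-- Complexification commutes with subtraction of vector fields. [folklore] -/
theorem complexify_comp_sub (u v : UnitAddTorus d → EuclideanSpace ℝ d) [Fintype d] :
    EuclideanSpace.complexify ∘ (u - v) =
      EuclideanSpace.complexify ∘ u - EuclideanSpace.complexify ∘ v := by
  funext x; simp

end Coeff

/-! ## The truncation operator -/

section Truncate

variable [DecidableEq d]

/-- The frequency ball is symmetric (membership form used by the `realTrigPoly` API). [folklore] -/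
theorem neg_mem_freqBall_of_mem {N : ℕ} : ∀ k ∈ freqBall (d := d) N, -k ∈ freqBall N :=
  fun _ hk => neg_mem_freqBall.2 hk

/-- The **Fourier truncation** (Galerkin projection at function level) of a real vector field:
`P_N u (x) = Re ∑_{|k|² ≤ N²} û(k) e^{2πi k·x}` with `û = 𝓕(complexify ∘ u)` — a real vector
trigonometric polynomial with the same Fourier coefficients as `u` on the ball and none outside.
This is the plain (scalar, componentwise) Fourier truncation, mean mode kept and no Leray
projection; on weakly divergence-free mean-zero `u` it agrees with the Galerkin projection `P_n`
of Robinson–Rodrigo–Sadowski 2016, §4.1, (4.1), p. 71 (projection onto the first Stokes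
eigenfunctions), by `isDivFree_fourierTruncate` (Constantin–Foias 1988, (8.3)). Junk (Bochner):
for non-integrable `u` all coefficients vanish and `P_N u = 0`. [cite: RobinsonRodrigoSadowski2016, §4.1 (4.1)] -/
def fourierTruncate (N : ℕ) (u : UnitAddTorus d → EuclideanSpace ℝ d) :
    UnitAddTorus d → EuclideanSpace ℝ d :=
  realTrigPoly (freqBall N) fun k => mFourierCoeff (EuclideanSpace.complexify ∘ u) k

/-- Unfolding `fourierTruncate`. [folklore] -/
theorem fourierTruncate_eq (N : ℕ) (u : UnitAddTorus d → EuclideanSpace ℝ d) :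
    fourierTruncate N u =
      realTrigPoly (freqBall N) fun k => mFourierCoeff (EuclideanSpace.complexify ∘ u) k := rfl

/-- Truncations are smooth. [folklore] -/
theorem isSmooth_fourierTruncate (N : ℕ) (u : UnitAddTorus d → EuclideanSpace ℝ d) :
    IsSmooth (fourierTruncate N u) :=
  isSmooth_realTrigPoly _ _

/-- Truncations are continuous. [folklore] -/
theorem continuous_fourierTruncate (N : ℕ) (u : UnitAddTorus d → EuclideanSpace ℝ d) :
    Continuous (fourierTruncate N u) :=
  continuous_realTrigPoly _ _

/-- Truncations are in every `L^p`. [folklore] -/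
theorem memLp_fourierTruncate (N : ℕ) (u : UnitAddTorus d → EuclideanSpace ℝ d) (p : ℝ≥0∞) :
    MemLp (fourierTruncate N u) p volume :=
  memLp_realTrigPoly _ _ p

/-- **Fourier coefficients of the truncation**: `𝓕(P_N u)(k) = û(k)` on the ball, `0` outside
(integrable `u`). [cite: RobinsonRodrigoSadowski2016, §4.1] -/
theorem mFourierCoeff_fourierTruncate {u : UnitAddTorus d → EuclideanSpace ℝ d}
    (hu : Integrable u volume) (N : ℕ) (k : d → ℤ) :
    mFourierCoeff (EuclideanSpace.complexify ∘ fourierTruncate N u) k =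
      if k ∈ freqBall N then mFourierCoeff (EuclideanSpace.complexify ∘ u) k else 0 :=
  mFourierCoeff_realTrigPoly neg_mem_freqBall_of_mem (isConjSymm_mFourierCoeff hu) k

/-- Inner products of a truncation with an `L²` field: `⟪P_N u, w⟫ = ∑_{|k|≤N} Re ⟪û k, ŵ k⟫_ℂ`. [folklore] -/
theorem integral_inner_fourierTruncate_left {u w : UnitAddTorus d → EuclideanSpace ℝ d}
    (hu : Integrable u volume) (hw : MemLp w 2 volume) (N : ℕ) :
    ∫ x, ⟪fourierTruncate N u x, w x⟫_ℝ =
      ∑ k ∈ freqBall N, (inner ℂ (mFourierCoeff (EuclideanSpace.complexify ∘ u) k)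
        (mFourierCoeff (EuclideanSpace.complexify ∘ w) k)).re :=
  integral_inner_realTrigPoly_left neg_mem_freqBall_of_mem (isConjSymm_mFourierCoeff hu) hw

/-- **The truncation is invisible to band-limited fields**: if `a ∈ L²` has no Fourier modes
outside the ball of radius `N`, then `⟪P_N u, a⟫_{L²} = ⟪u, a⟫_{L²}` for `u ∈ L²` (Parseval on
both sides; RRS 2016, §4.1: `P_n` is the orthogonal projection onto the modes `≤ n`). [cite: RobinsonRodrigoSadowski2016, §4.1] -/
theorem integral_inner_fourierTruncate_eq {u a : UnitAddTorus d → EuclideanSpace ℝ d}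
    (hu : MemLp u 2 volume) (ha : MemLp a 2 volume) {N : ℕ}
    (hband : ∀ k ∉ freqBall N, mFourierCoeff (EuclideanSpace.complexify ∘ a) k = 0) :
    ∫ x, ⟪fourierTruncate N u x, a x⟫_ℝ = ∫ x, ⟪u x, a x⟫_ℝ := by
  rw [integral_inner_fourierTruncate_left (hu.integrable one_le_two) ha]
  have h := hasSum_re_inner_mFourierCoeff_complexify hu ha
  have h' : HasSum (fun k : d → ℤ => (inner ℂ (mFourierCoeff (EuclideanSpace.complexify ∘ u) k)
      (mFourierCoeff (EuclideanSpace.complexify ∘ a) k)).re)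
      (∑ k ∈ freqBall N, (inner ℂ (mFourierCoeff (EuclideanSpace.complexify ∘ u) k)
        (mFourierCoeff (EuclideanSpace.complexify ∘ a) k)).re) :=
    hasSum_sum_of_ne_finset_zero fun k hk => by rw [hband k hk, inner_zero_right, Complex.zero_re]
  exact (h.unique h').symm

/-- **Bessel/Parseval for the truncation**: `∫ ‖P_N u‖² = ∑_{|k|≤N} ‖û k‖²`. [cite: Grafakos2014, Prop. 3.2.7 (3)] -/
theorem integral_norm_sq_fourierTruncate {u : UnitAddTorus d → EuclideanSpace ℝ d}
    (hu : Integrable u volume) (N : ℕ) :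
    ∫ x, ‖fourierTruncate N u x‖ ^ 2 =
      ∑ k ∈ freqBall N, ‖mFourierCoeff (EuclideanSpace.complexify ∘ u) k‖ ^ 2 :=
  integral_norm_sq_realTrigPoly neg_mem_freqBall_of_mem (isConjSymm_mFourierCoeff hu)

/-- **Bessel's inequality for the truncation**: `∫ ‖P_N u‖² ≤ ∫ ‖u‖²` for `u ∈ L²`. [folklore] -/
theorem integral_norm_sq_fourierTruncate_le {u : UnitAddTorus d → EuclideanSpace ℝ d}
    (hu : MemLp u 2 volume) (N : ℕ) :
    ∫ x, ‖fourierTruncate N u x‖ ^ 2 ≤ ∫ x, ‖u x‖ ^ 2 := by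
  rw [integral_norm_sq_fourierTruncate (hu.integrable one_le_two)]
  exact sum_le_hasSum _ (fun k _ => sq_nonneg _) (hasSum_sq_norm_mFourierCoeff_complexify hu)

/-- Kinetic energy does not increase under truncation: `E(P_N u) ≤ E(u)`. [folklore] -/
theorem kineticEnergy_fourierTruncate_le {u : UnitAddTorus d → EuclideanSpace ℝ d}
    (hu : MemLp u 2 volume) (N : ℕ) :
    kineticEnergy (fourierTruncate N u) ≤ kineticEnergy u := by
  unfold kineticEnergy
  exact mul_le_mul_of_nonneg_left (integral_norm_sq_fourierTruncate_le hu N) (by norm_num)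

/-- Fourier coefficients of the truncation error `P_N u - u`: `0` on the ball, `-û(k)` outside. [folklore] -/
theorem mFourierCoeff_fourierTruncate_sub {u : UnitAddTorus d → EuclideanSpace ℝ d}
    (hu : Integrable u volume) (N : ℕ) (k : d → ℤ) :
    mFourierCoeff (EuclideanSpace.complexify ∘ (fourierTruncate N u - u)) k =
      if k ∈ freqBall N then 0 else -mFourierCoeff (EuclideanSpace.complexify ∘ u) k := by
  rw [complexify_comp_sub, mFourierCoeff_sub (integrable_complexify_comp
      (isSmooth_fourierTruncate N u).integrable) (integrable_complexify_comp hu),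
    mFourierCoeff_fourierTruncate hu]
  split_ifs <;> simp

/-- **The truncation error in `L²`, spectrally**: `∫⁻ ‖P_N u - u‖ₑ² = ∑_{|k| > N} ‖û k‖ₑ²`
(Parseval for `P_N u - u ∈ L²`; Robinson–Rodrigo–Sadowski 2016, Lemma 4.1 and p. 74). [cite: RobinsonRodrigoSadowski2016, Lemma 4.1, p. 74] -/
theorem lintegral_enorm_sq_fourierTruncate_sub {u : UnitAddTorus d → EuclideanSpace ℝ d}
    (hu : MemLp u 2 volume) (N : ℕ) :
    ∫⁻ x, ‖fourierTruncate N u x - u x‖ₑ ^ 2 =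
      ∑' k : {k : d → ℤ // k ∉ freqBall N},
        ‖mFourierCoeff (EuclideanSpace.complexify ∘ u) k‖ₑ ^ 2 := by
  have hsub : MemLp (fourierTruncate N u - u) 2 volume := (memLp_fourierTruncate N u 2).sub hu
  have h := tsum_enorm_sq_mFourierCoeff_complexify hsub
  rw [show (fun x => ‖fourierTruncate N u x - u x‖ₑ ^ 2) =
      fun x => ‖(fourierTruncate N u - u) x‖ₑ ^ 2 from rfl, ← h,
    show (∑' k : {k : d → ℤ // k ∉ freqBall N},
      ‖mFourierCoeff (EuclideanSpace.complexify ∘ u) k‖ₑ ^ 2) =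
      ∑' k : ({k : d → ℤ | k ∉ freqBall N} : Set (d → ℤ)),
        ‖mFourierCoeff (EuclideanSpace.complexify ∘ u) k‖ₑ ^ 2 from rfl,
    tsum_subtype ({k : d → ℤ | k ∉ freqBall N} : Set (d → ℤ))
      fun k => ‖mFourierCoeff (EuclideanSpace.complexify ∘ u) k‖ₑ ^ 2]
  refine tsum_congr fun k => ?_
  rw [mFourierCoeff_fourierTruncate_sub (hu.integrable one_le_two)]
  simp only [Set.indicator_apply, Set.mem_setOf_eq]
  by_cases hk : k ∈ freqBall N
  · simp [hk]
  · simp [hk]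

/-- **`P_N u → u` in `L²`** for `u ∈ L²(T^d; ℝ^d)`, squared-`lintegral` form: the Parseval tail
`∑_{|k|>N} ‖û k‖²` tends to `0` since the balls exhaust `ℤ^d`
(Robinson–Rodrigo–Sadowski 2016, Lemma 4.1; the `L²` case is p. 74, `‖P_n u₀ - u₀‖ → 0`). [cite: RobinsonRodrigoSadowski2016, Lemma 4.1, p. 74] -/
theorem tendsto_lintegral_enorm_sq_fourierTruncate_sub {u : UnitAddTorus d → EuclideanSpace ℝ d}
    (hu : MemLp u 2 volume) :
    Tendsto (fun N => ∫⁻ x, ‖fourierTruncate N u x - u x‖ₑ ^ 2) atTop (𝓝 0) := by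
  simp_rw [lintegral_enorm_sq_fourierTruncate_sub hu]
  have hfin : ∑' k : d → ℤ, ‖mFourierCoeff (EuclideanSpace.complexify ∘ u) k‖ₑ ^ 2 ≠ ⊤ := by
    rw [tsum_enorm_sq_mFourierCoeff_complexify hu]
    have h2 := hu.2
    rw [eLpNorm_lt_top_iff_lintegral_rpow_enorm_lt_top two_ne_zero ENNReal.ofNat_ne_top] at h2
    simpa [ENNReal.toReal_ofNat] using h2.ne
  exact (ENNReal.tendsto_tsum_compl_atTop_zero hfin).comp tendsto_freqBall_atTop

/-- **`P_N u → u` in `L²`** for `u ∈ L²(T^d; ℝ^d)`: `‖P_N u - u‖_{L²} → 0` as `N → ∞`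
(Robinson–Rodrigo–Sadowski 2016, Lemma 4.1; the `L²` case is p. 74, `‖P_n u₀ - u₀‖ → 0`). [cite: RobinsonRodrigoSadowski2016, Lemma 4.1, p. 74] -/
theorem tendsto_eLpNorm_fourierTruncate_sub {u : UnitAddTorus d → EuclideanSpace ℝ d}
    (hu : MemLp u 2 volume) :
    Tendsto (fun N => eLpNorm (fourierTruncate N u - u) 2 volume) atTop (𝓝 0) := by
  have h := tendsto_lintegral_enorm_sq_fourierTruncate_sub hu
  have h2 : Tendsto (fun N => (∫⁻ x, ‖fourierTruncate N u x - u x‖ₑ ^ 2) ^ (1 / 2 : ℝ))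
      atTop (𝓝 0) := by
    have hc : ContinuousAt (fun a : ℝ≥0∞ => a ^ (1 / 2 : ℝ)) 0 :=
      ENNReal.continuous_rpow_const.continuousAt
    have := hc.tendsto.comp h
    rw [ENNReal.zero_rpow_of_pos (by norm_num : (0 : ℝ) < 1 / 2)] at this
    exact this
  refine h2.congr fun N => ?_
  rw [eLpNorm_eq_lintegral_rpow_enorm_toReal two_ne_zero ENNReal.ofNat_ne_top]
  simp only [ENNReal.toReal_ofNat, ENNReal.rpow_ofNat, Pi.sub_apply, one_div]

end Truncate

/-! ## Transversality of Fourier coefficients of divergence-free fields -/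

section Transversal

variable [DecidableEq d]

/-- The gradient in coordinates against a vector: `⟪v, ∇θ(x)⟫ = ∑ⱼ vⱼ ∂ⱼθ(x)` for `C¹`
scalar `θ` (`Torus.gradient` is Mathlib's gradient of the re-centred lift; expand `v` in the
standard orthonormal basis and use `Torus.partialDeriv_eq_fderiv_apply`). [folklore] -/
theorem inner_gradient_eq_sum_mul_partialDeriv {θ : UnitAddTorus d → ℝ} (hθ : IsContDiff 1 θ)
    (v : EuclideanSpace ℝ d) (x : UnitAddTorus d) :
    ⟪v, gradient θ x⟫_ℝ = ∑ j, v j * partialDeriv j θ x := by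
  rw [real_inner_comm, Torus.gradient, _root_.gradient, InnerProductSpace.toDual_symm_apply]
  change Torus.fderiv θ x v = _
  conv_lhs => rw [← (EuclideanSpace.basisFun d ℝ).sum_repr' v]
  rw [map_sum]
  refine Finset.sum_congr rfl fun j _ => ?_
  rw [map_smul, EuclideanSpace.basisFun_apply, EuclideanSpace.inner_single_left,
    ← partialDeriv_eq_fderiv_apply hθ, smul_eq_mul]
  simp

omit [DecidableEq d] in
/-- The scalar test functions `θ_z = Re (z e_{-k})`, as real parts of one-mode trigonometric
polynomials, are smooth. [folklore] -/
theorem isSmooth_re_trigPoly (S : Finset (d → ℤ)) (c : (d → ℤ) → ℂ) :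
    IsSmooth (fun x : UnitAddTorus d => (trigPoly S c x).re) :=
  IsSmooth.comp_clm Complex.reCLM (isSmooth_trigPoly S c)

/-- Partial derivatives of `Re ∘ trigPoly`: `∂ⱼ Re (trigPoly S c) = Re (trigPoly S (2πi kⱼ c))`. [folklore] -/
theorem partialDeriv_re_trigPoly (S : Finset (d → ℤ)) (c : (d → ℤ) → ℂ) (j : d)
    (x : UnitAddTorus d) :
    partialDeriv j (fun y : UnitAddTorus d => (trigPoly S c y).re) x =
      (trigPoly S (fun k => (2 * Real.pi * Complex.I * (k j)) • c k) x).re := by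
  have h : (fun y : UnitAddTorus d => (trigPoly S c y).re) = Complex.reCLM ∘ trigPoly S c := rfl
  rw [h, partialDeriv_clm_comp (isSmooth_trigPoly S c), partialDeriv_trigPoly]
  rfl

omit [DecidableEq d] in
/-- Coordinates of complexified `L²` fields are integrable against characters, and the integral is
the corresponding coordinate of the vector Fourier coefficient:
`∫ e_{-k}(x) (u x)ⱼ dx = (𝓕(complexify ∘ u)(k))ⱼ`. [folklore] -/
theorem integral_mFourier_neg_mul_coord {u : UnitAddTorus d → EuclideanSpace ℝ d}
    (hu : Integrable u volume) (k : d → ℤ) (j : d) :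
    ∫ x, mFourier (-k) x * (u x j : ℂ) = mFourierCoeff (EuclideanSpace.complexify ∘ u) k j := by
  rw [mFourierCoeff_complexify_apply hu, mFourierCoeff_eq_integral_volume]
  rfl

/-- **Weakly divergence-free `L²` fields have transversal Fourier coefficients**:
`∑ⱼ kⱼ û(k)ⱼ = 0` for every `k ∈ ℤ^d`, `û = 𝓕(complexify ∘ u)`. Proof: test the weak
divergence-free condition `∫ ⟪u, ∇θ⟫ = 0` against `θ = Re (z e_{-k})`, `z = 1, i`, whose gradient
is `Re (-2πi z k e_{-k})`; this gives `Re (-2πi z ∑ⱼ kⱼ û(k)ⱼ) = 0` for both `z`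
(Robinson–Rodrigo–Sadowski 2016, Ex. 2.14, solution p. 310: `0 = ∫ u · ∇e^{-ik·x} = -(2π)³ i k · û_k`;
Def. 2.1, p. 42: `H = {u : û_{-k} = conj û_k, k · û_k = 0}`; the converse is Lemma 2.3).
[cite: RobinsonRodrigoSadowski2016, Ex. 2.14 (solution p. 310)] -/
theorem IsWeaklyDivFree.sum_mul_mFourierCoeff_eq_zero {u : UnitAddTorus d → EuclideanSpace ℝ d}
    (hu : MemLp u 2 volume) (hdiv : IsWeaklyDivFree u) (k : d → ℤ) :
    ∑ j, (k j : ℂ) * mFourierCoeff (EuclideanSpace.complexify ∘ u) k j = 0 := by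
  have hui : Integrable u volume := hu.integrable one_le_two
  set Z : ℂ := ∑ j, (k j : ℂ) * mFourierCoeff (EuclideanSpace.complexify ∘ u) k j with hZ
  -- the pairing with `θ_z = Re (z e_{-k})` computes `Re (-2πi z Z)`
  have key : ∀ z : ℂ, (-(2 * Real.pi * Complex.I) * z * Z).re = 0 := by
    intro z
    set c : (d → ℤ) → ℂ := fun _ => z with hc_def
    have hθ : IsSmooth (fun x : UnitAddTorus d => (trigPoly {-k} c x).re) := isSmooth_re_trigPoly _ _
    have h0 := hdiv _ hθ
    -- expand the integrand
    have hpt : ∀ x, ⟪u x, gradient (fun y : UnitAddTorus d => (trigPoly {-k} c y).re) x⟫_ℝ =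
        (∑ j, mFourier (-k) x * (u x j : ℂ) * (-(2 * Real.pi * Complex.I) * (k j) * z)).re := by
      intro x
      rw [inner_gradient_eq_sum_mul_partialDeriv (hθ.isContDiff (by simp)), Complex.re_sum]
      refine Finset.sum_congr rfl fun j _ => ?_
      rw [partialDeriv_re_trigPoly, trigPoly_apply, Finset.sum_singleton]
      simp only [hc_def, Pi.neg_apply, Int.cast_neg, smul_eq_mul, ← Complex.re_ofReal_mul]
      congr 1
      ring
    simp_rw [hpt] at h0
    -- integrability of the complex integrand, and `∫ Re = Re ∫`
    have hint : ∀ j : d, Integrable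
        (fun x => mFourier (-k) x * (u x j : ℂ) * (-(2 * Real.pi * Complex.I) * (k j) * z)) volume := by
      intro j
      refine Integrable.mul_const ?_ _
      have huj : Integrable (fun x => (u x j : ℂ)) volume :=
        Complex.ofRealCLM.integrable_comp (hui.eval_piLp j)
      exact huj.bdd_mul (c := 1) (mFourier (-k)).continuous.aestronglyMeasurable
        (Eventually.of_forall fun x => ((mFourier (-k)).norm_coe_le_norm x).trans_eq mFourier_norm)
    have hsum : Integrable (fun x => ∑ j, mFourier (-k) x * (u x j : ℂ) *
        (-(2 * Real.pi * Complex.I) * (k j) * z)) volume := integrable_finsetSum _ fun j _ => hint j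
    have hre := integral_re hsum
    simp only [RCLike.re_to_complex] at hre
    rw [hre] at h0
    rw [integral_finsetSum _ fun j _ => hint j] at h0
    simp_rw [integral_mul_const, integral_mFourier_neg_mul_coord hui] at h0
    rw [← h0]
    congr 1
    rw [hZ, Finset.mul_sum]
    refine Finset.sum_congr rfl fun j _ => ?_
    ring
  -- `z = 1` and `z = i` give `Im Z = 0` and `Re Z = 0`
  have h1 := key 1
  have h2 := key Complex.I
  simp only [mul_one, neg_mul, Complex.neg_re, Complex.mul_re, Complex.mul_im,
    Complex.re_ofNat, Complex.im_ofNat, Complex.ofReal_re, Complex.ofReal_im, Complex.I_re,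
    Complex.I_im, mul_zero, zero_mul, sub_zero, add_zero, mul_one, zero_sub, neg_neg] at h1 h2
  apply Complex.ext
  · simp only [Complex.zero_re]
    nlinarith [Real.pi_pos]
  · simp only [Complex.zero_im]
    nlinarith [Real.pi_pos]

/-- The Fourier coefficients of a weakly divergence-free `L²` field are transversal on every
frequency set (Robinson–Rodrigo–Sadowski 2016, Ex. 2.14). [cite: RobinsonRodrigoSadowski2016, Ex. 2.14 (solution p. 310)] -/
theorem IsWeaklyDivFree.isTransversal_mFourierCoeff {u : UnitAddTorus d → EuclideanSpace ℝ d}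
    (hu : MemLp u 2 volume) (hdiv : IsWeaklyDivFree u) (S : Finset (d → ℤ)) :
    IsTransversal S fun k => mFourierCoeff (EuclideanSpace.complexify ∘ u) k :=
  fun k _ => hdiv.sum_mul_mFourierCoeff_eq_zero hu k

/-- **Truncations of weakly divergence-free `L²` fields are divergence free** (classically):
`div (P_N u) = 0` (the truncation commutes with the Leray projector, which commutes with
derivatives: Robinson–Rodrigo–Sadowski 2016, Lemma 2.9, p. 45; Constantin–Foias 1988, (8.4)). [cite: RobinsonRodrigoSadowski2016, Lemma 2.9] -/
theorem isDivFree_fourierTruncate {u : UnitAddTorus d → EuclideanSpace ℝ d}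
    (hu : MemLp u 2 volume) (hdiv : IsWeaklyDivFree u) (N : ℕ) :
    IsDivFree (fourierTruncate N u) :=
  isDivFree_realTrigPoly (hdiv.isTransversal_mFourierCoeff hu (freqBall N))

/-- Coordinates of the Fourier coefficient of a partial derivative of a smooth real vector field:
`(𝓕(complexify ∘ ∂ⱼ a)(k))ᵢ = 2πi kⱼ (𝓕(complexify ∘ a)(k))ᵢ`. [folklore] -/
theorem mFourierCoeff_complexify_partialDeriv {a : UnitAddTorus d → EuclideanSpace ℝ d}
    (ha : IsSmooth a) (j : d) (k : d → ℤ) :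
    mFourierCoeff (EuclideanSpace.complexify ∘ partialDeriv j a) k =
      (2 * Real.pi * Complex.I * (k j)) • mFourierCoeff (EuclideanSpace.complexify ∘ a) k := by
  rw [← mFourierCoeff_partialDeriv ha.complexify_comp j k]
  congr 1
  funext x
  exact (partialDeriv_complexify_comp ha j x).symm

/-- **Smooth divergence-free fields have transversal Fourier coefficients**:
`∑ⱼ kⱼ â(k)ⱼ = 0`, since `0 = 𝓕(div a)(k) = ∑ⱼ 𝓕(∂ⱼ aⱼ)(k) = 2πi ∑ⱼ kⱼ â(k)ⱼ`
(Grafakos 2014, Prop. 3.2.6 (8); Robinson–Rodrigo–Sadowski 2016, §2.1, p. 42: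
`div (û_k e^{ik·x}) = i (k · û_k) e^{ik·x}`). [cite: RobinsonRodrigoSadowski2016, Def. 2.1] -/
theorem IsDivFree.sum_mul_mFourierCoeff_eq_zero {a : UnitAddTorus d → EuclideanSpace ℝ d}
    (ha : IsSmooth a) (hdiv : IsDivFree a) (k : d → ℤ) :
    ∑ j, (k j : ℂ) * mFourierCoeff (EuclideanSpace.complexify ∘ a) k j = 0 := by
  -- `∑ⱼ 𝓕(complexify ∘ ∂ⱼ a)(k)ⱼ = 𝓕(div a)(k) = 0`
  have hcoord : ∀ j : d, mFourierCoeff (EuclideanSpace.complexify ∘ partialDeriv j a) k j =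
      mFourierCoeff (fun x => ((partialDeriv j (fun y => a y j) x : ℝ) : ℂ)) k := by
    intro j
    rw [mFourierCoeff_complexify_apply (ha.partialDeriv j).integrable]
    congr 1
    funext x
    have h := partialDeriv_clm_comp ha (EuclideanSpace.proj j : EuclideanSpace ℝ d →L[ℝ] ℝ) j x
    exact congrArg (fun r : ℝ => (r : ℂ)) h.symm
  have hdivF : mFourierCoeff (fun x => (divergence a x : ℂ)) k = 0 := by
    have : (fun x => (divergence a x : ℂ)) = fun _ => (0 : ℂ) := by
      funext x; rw [hdiv x, Complex.ofReal_zero]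
    rw [this]
    simp [mFourierCoeff]
  have hsplit : mFourierCoeff (fun x => (divergence a x : ℂ)) k =
      ∑ j, mFourierCoeff (fun x => ((partialDeriv j (fun y => a y j) x : ℝ) : ℂ)) k := by
    simp only [divergence, Complex.ofReal_sum, mFourierCoeff_eq_integral_volume, Finset.smul_sum]
    exact integral_finsetSum _ fun j _ => integrable_mFourier_smul'
      (Complex.ofRealCLM.integrable_comp ((ha.apply j).partialDeriv j).integrable) k
  rw [hsplit] at hdivF
  simp_rw [← hcoord, mFourierCoeff_complexify_partialDeriv ha, PiLp.smul_apply, smul_eq_mul,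
    mul_assoc, ← Finset.mul_sum] at hdivF
  simpa [Real.pi_ne_zero, Complex.I_ne_zero] using hdivF

/-- The Fourier coefficients of a smooth divergence-free field are transversal on every
frequency set (Robinson–Rodrigo–Sadowski 2016, §2.1, Def. 2.1). [cite: RobinsonRodrigoSadowski2016, Def. 2.1] -/
theorem IsDivFree.isTransversal_mFourierCoeff {a : UnitAddTorus d → EuclideanSpace ℝ d}
    (ha : IsSmooth a) (hdiv : IsDivFree a) (S : Finset (d → ℤ)) :
    IsTransversal S fun k => mFourierCoeff (EuclideanSpace.complexify ∘ a) k :=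
  fun k _ => hdiv.sum_mul_mFourierCoeff_eq_zero ha k

end Transversal

/-! ## Coefficient vectors on a finite frequency set

The Galerkin systems built on `realTrigPoly S` live in the finite-dimensional space
`↥S → ℂ^d` of coefficient vectors indexed by the finite type `↥S`; this section is the
(purely bookkeeping) dictionary with families on all of `ℤ^d`. -/

section CoeffVector

variable {S : Finset (d → ℤ)}

/-- Extension by zero of a coefficient vector on the finite frequency set `S` to all of `ℤ^d`
(the form consumed by `Torus.trigPoly` / `Torus.realTrigPoly`). [folklore] -/
def coeffExt (S : Finset (d → ℤ)) (c : ↥S → EuclideanSpace ℂ d) : (d → ℤ) → EuclideanSpace ℂ d :=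
  fun k => if h : k ∈ S then c ⟨k, h⟩ else 0

/-- On `S` the extension is the given vector. [folklore] -/
theorem coeffExt_of_mem (c : ↥S → EuclideanSpace ℂ d) {k : d → ℤ} (hk : k ∈ S) :
    coeffExt S c k = c ⟨k, hk⟩ := dif_pos hk

/-- Off `S` the extension vanishes. [folklore] -/
theorem coeffExt_of_not_mem (c : ↥S → EuclideanSpace ℂ d) {k : d → ℤ} (hk : k ∉ S) :
    coeffExt S c k = 0 := dif_neg hk

/-- On elements of `S` the extension is the given vector. [folklore] -/
@[simp]
theorem coeffExt_coe (c : ↥S → EuclideanSpace ℂ d) (k : ↥S) : coeffExt S c k = c k := by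
  rw [coeffExt_of_mem c k.2]

/-- Extension by zero is additive. [folklore] -/
theorem coeffExt_add (c c' : ↥S → EuclideanSpace ℂ d) :
    coeffExt S (c + c') = coeffExt S c + coeffExt S c' := by
  funext k
  by_cases hk : k ∈ S
  · simp [coeffExt, hk]
  · simp [coeffExt, hk]

/-- Extension by zero respects differences. [folklore] -/
theorem coeffExt_sub (c c' : ↥S → EuclideanSpace ℂ d) :
    coeffExt S (c - c') = coeffExt S c - coeffExt S c' := by
  funext k
  by_cases hk : k ∈ S
  · simp [coeffExt, hk]
  · simp [coeffExt, hk]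

/-- Extension by zero commutes with real scalars. [folklore] -/
theorem coeffExt_smul (a : ℝ) (c : ↥S → EuclideanSpace ℂ d) :
    coeffExt S (a • c) = a • coeffExt S c := by
  funext k
  by_cases hk : k ∈ S
  · simp [coeffExt, hk]
  · simp [coeffExt, hk]

/-- The extension of the zero vector is zero. [folklore] -/
@[simp]
theorem coeffExt_zero : coeffExt S (0 : ↥S → EuclideanSpace ℂ d) = 0 := by
  funext k
  by_cases hk : k ∈ S
  · simp [coeffExt, hk]
  · simp [coeffExt, hk]

/-- Sums over `S` of functions of the extended coefficients are sums over the finite type `↥S`.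
[folklore] -/
theorem sum_coeffExt {M : Type*} [AddCommMonoid M] (F : (d → ℤ) → EuclideanSpace ℂ d → M)
    (c : ↥S → EuclideanSpace ℂ d) :
    ∑ k ∈ S, F k (coeffExt S c k) = ∑ k : ↥S, F k (c k) := by
  rw [← Finset.sum_coe_sort]
  exact Finset.sum_congr rfl fun k _ => by rw [coeffExt_coe]

/-- Coordinates of the extension are bounded by the sup norm. [folklore] -/
theorem norm_coeffExt_le (c : ↥S → EuclideanSpace ℂ d) (k : d → ℤ) : ‖coeffExt S c k‖ ≤ ‖c‖ := by
  by_cases hk : k ∈ S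
  · rw [coeffExt_of_mem c hk]
    exact norm_le_pi_norm c ⟨k, hk⟩
  · rw [coeffExt_of_not_mem c hk, norm_zero]
    exact norm_nonneg _

/-- The sup norm of a coefficient vector is controlled by its `ℓ²` norm:
`‖c‖ ≤ (∑_k ‖c k‖²)^{1/2}`. [folklore] -/
theorem norm_le_sqrt_sum_norm_sq (c : ↥S → EuclideanSpace ℂ d) :
    ‖c‖ ≤ Real.sqrt (∑ k, ‖c k‖ ^ 2) := by
  refine (pi_norm_le_iff_of_nonneg (Real.sqrt_nonneg _)).2 fun k => ?_
  refine le_trans (le_abs_self _) (Real.abs_le_sqrt ?_)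
  exact Finset.single_le_sum (f := fun k => ‖c k‖ ^ 2) (fun k _ => sq_nonneg _)
    (Finset.mem_univ k)

/-- `‖c‖² ≤ ∑_k ‖c k‖²` for the sup norm. [folklore] -/
theorem norm_sq_le_sum_norm_sq (c : ↥S → EuclideanSpace ℂ d) : ‖c‖ ^ 2 ≤ ∑ k, ‖c k‖ ^ 2 := by
  have h := norm_le_sqrt_sum_norm_sq c
  have h0 : 0 ≤ ∑ k, ‖c k‖ ^ 2 := Finset.sum_nonneg fun k _ => sq_nonneg _
  calc ‖c‖ ^ 2 ≤ (Real.sqrt (∑ k, ‖c k‖ ^ 2)) ^ 2 := pow_le_pow_left₀ (norm_nonneg _) h 2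
    _ = ∑ k, ‖c k‖ ^ 2 := Real.sq_sqrt h0

/-- The same in `ℝ≥0∞`: `‖c‖ₑ² ≤ ∑_k ‖c k‖ₑ²`. [folklore] -/
theorem enorm_sq_le_sum_enorm_sq (c : ↥S → EuclideanSpace ℂ d) :
    ‖c‖ₑ ^ 2 ≤ ∑ k, ‖c k‖ₑ ^ 2 := by
  have h := norm_sq_le_sum_norm_sq c
  calc ‖c‖ₑ ^ 2 = ENNReal.ofReal (‖c‖ ^ 2) := by
        rw [← ofReal_norm, ENNReal.ofReal_pow (norm_nonneg _)]
    _ ≤ ENNReal.ofReal (∑ k, ‖c k‖ ^ 2) := ENNReal.ofReal_le_ofReal h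
    _ = ∑ k, ‖c k‖ₑ ^ 2 := by
        rw [ENNReal.ofReal_sum_of_nonneg fun k _ => sq_nonneg _]
        exact Finset.sum_congr rfl fun k _ => by
          rw [← ofReal_norm, ENNReal.ofReal_pow (norm_nonneg _)]

/-- Conversely `∑_k ‖c k‖² ≤ #S ‖c‖²`. [folklore] -/
theorem sum_norm_sq_le_card_mul_norm_sq (c : ↥S → EuclideanSpace ℂ d) :
    ∑ k, ‖c k‖ ^ 2 ≤ S.card * ‖c‖ ^ 2 := by
  calc ∑ k, ‖c k‖ ^ 2 ≤ ∑ _k : ↥S, ‖c‖ ^ 2 :=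
        Finset.sum_le_sum fun k _ => pow_le_pow_left₀ (norm_nonneg _) (norm_le_pi_norm c k) 2
    _ = S.card * ‖c‖ ^ 2 := by simp

/-- The real trigonometric polynomial of a coefficient vector only sees the coefficients on `S`:
restricting a family to `S` and extending back gives the same field. [folklore] -/
theorem realTrigPoly_coeffExt_restrict (C : (d → ℤ) → EuclideanSpace ℂ d) :
    realTrigPoly S (coeffExt S fun k : ↥S => C k) = realTrigPoly S C :=
  realTrigPoly_congr fun k hk => by rw [coeffExt_of_mem _ hk]

/-- **Real coefficient vectors**: `c (-k) = conj (c k)` on `S` (the reality condition on the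
Fourier coefficients of a real field; Robinson–Rodrigo–Sadowski 2016, §1.5, (1.10), p. 27, and
Def. 2.1, p. 42). [cite: RobinsonRodrigoSadowski2016, §1.5 (1.10)] -/
def IsRealCoeff (c : ↥S → EuclideanSpace ℂ d) : Prop :=
  ∀ k l : ↥S, (l : d → ℤ) = -(k : d → ℤ) → c l = EuclideanSpace.conjVec (c k)

/-- **Divergence-free (transversal) coefficient vectors**: `k · c k = 0` on `S`
(Robinson–Rodrigo–Sadowski 2016, §2.1, Def. 2.1, p. 42). [cite: RobinsonRodrigoSadowski2016, Def. 2.1] -/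
def IsSolenoidalCoeff (c : ↥S → EuclideanSpace ℂ d) : Prop :=
  ∀ k : ↥S, ∑ j, ((k : d → ℤ) j : ℂ) * c k j = 0

/-- Real coefficient vectors extend to conjugate-symmetric families (on a symmetric `S`). [folklore] -/
theorem IsRealCoeff.isConjSymm_coeffExt (hS : ∀ k ∈ S, -k ∈ S) {c : ↥S → EuclideanSpace ℂ d}
    (hc : IsRealCoeff c) : IsConjSymm (coeffExt S c) := by
  intro k
  by_cases hk : k ∈ S
  · rw [coeffExt_of_mem c hk, coeffExt_of_mem c (hS k hk)]
    exact hc ⟨k, hk⟩ ⟨-k, hS k hk⟩ rfl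
  · have hnk : -k ∉ S := fun h => hk (by simpa using hS (-k) h)
    rw [coeffExt_of_not_mem c hk, coeffExt_of_not_mem c hnk, EuclideanSpace.conjVec_zero]

/-- Transversal coefficient vectors extend to transversal families. [folklore] -/
theorem IsSolenoidalCoeff.isTransversal_coeffExt {c : ↥S → EuclideanSpace ℂ d}
    (hc : IsSolenoidalCoeff c) : IsTransversal S (coeffExt S c) := by
  intro k hk
  have h := hc ⟨k, hk⟩
  rwa [← coeffExt_of_mem c hk] at h

omit [Fintype d] in
/-- Restrictions of conjugate-symmetric families are real coefficient vectors. [folklore] -/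
theorem isRealCoeff_restrict {C : (d → ℤ) → EuclideanSpace ℂ d} (hC : IsConjSymm C) :
    IsRealCoeff (S := S) fun k => C k := by
  intro k l h
  show C l = EuclideanSpace.conjVec (C k)
  rw [h]
  exact hC k

/-- Restrictions of transversal families are transversal coefficient vectors. [folklore] -/
theorem isSolenoidalCoeff_restrict {C : (d → ℤ) → EuclideanSpace ℂ d} (hC : IsTransversal S C) :
    IsSolenoidalCoeff (S := S) fun k => C k :=
  fun k => hC k k.2

/-- Conjugation of a real multiple. [folklore] -/
theorem _root_.Literature.Analysis.FunctionSpaces.EuclideanSpace.conjVec_real_smul {ι : Type*} (a : ℝ) (w : EuclideanSpace ℂ ι) :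
    EuclideanSpace.conjVec (a • w) = a • EuclideanSpace.conjVec w := by
  ext i; simp [EuclideanSpace.conjVec_apply]

omit [Fintype d] in
/-- Real coefficient vectors form a real subspace: sums. [folklore] -/
theorem IsRealCoeff.add {c c' : ↥S → EuclideanSpace ℂ d} (hc : IsRealCoeff c)
    (hc' : IsRealCoeff c') : IsRealCoeff (c + c') := fun k l h => by
  rw [Pi.add_apply, Pi.add_apply, hc k l h, hc' k l h, EuclideanSpace.conjVec_add]

omit [Fintype d] in
/-- Real coefficient vectors form a real subspace: real multiples. [folklore] -/
theorem IsRealCoeff.smul {c : ↥S → EuclideanSpace ℂ d} (hc : IsRealCoeff c) (a : ℝ) :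
    IsRealCoeff (a • c) := fun k l h => by
  rw [Pi.smul_apply, Pi.smul_apply, hc k l h, EuclideanSpace.conjVec_real_smul]

omit [Fintype d] in
/-- Real coefficient vectors form a real subspace: differences. [folklore] -/
theorem IsRealCoeff.sub {c c' : ↥S → EuclideanSpace ℂ d} (hc : IsRealCoeff c)
    (hc' : IsRealCoeff c') : IsRealCoeff (c - c') := by
  rw [sub_eq_add_neg, ← neg_one_smul ℝ c']
  exact hc.add (hc'.smul (-1))

/-- The Fourier coefficients of a real integrable field, restricted to `S`, form a real
coefficient vector. [folklore] -/
theorem isRealCoeff_mFourierCoeff {u : UnitAddTorus d → EuclideanSpace ℝ d}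
    (hu : Integrable u volume) :
    IsRealCoeff (S := S) fun k => mFourierCoeff (EuclideanSpace.complexify ∘ u) k :=
  isRealCoeff_restrict (isConjSymm_mFourierCoeff hu)

/-! ### Symmetrisation of coefficient vectors -/

section Symmetrise

/-- The frequency `-k` as an element of the (symmetric) frequency set `S`. [folklore] -/
def negIdx {S : Finset (d → ℤ)} (hS : ∀ k ∈ S, -k ∈ S) (k : ↥S) : ↥S :=
  ⟨-(k : d → ℤ), hS k k.2⟩

omit [Fintype d] in
/-- The underlying frequency of `negIdx` is `-k`. [folklore] -/
@[simp]
theorem coe_negIdx {S : Finset (d → ℤ)} (hS : ∀ k ∈ S, -k ∈ S) (k : ↥S) :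
    (negIdx hS k : d → ℤ) = -(k : d → ℤ) := rfl

omit [Fintype d] in
/-- `negIdx` is an involution. [folklore] -/
theorem negIdx_negIdx {S : Finset (d → ℤ)} (hS : ∀ k ∈ S, -k ∈ S) (k : ↥S) :
    negIdx hS (negIdx hS k) = k :=
  Subtype.ext (neg_neg _)

/-- **Symmetrisation** `c ↦ (k ↦ ½ (c k + conj (c (-k))))`: a real-linear retraction of
`S → ℂ^d` onto the real coefficient vectors, `1`-Lipschitz for the sup norm. [folklore] -/
def symmetrise (hS : ∀ k ∈ S, -k ∈ S) (c : ↥S → EuclideanSpace ℂ d) : ↥S → EuclideanSpace ℂ d :=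
  fun k => (2⁻¹ : ℝ) • (c k + EuclideanSpace.conjVec (c (negIdx hS k)))

omit [Fintype d] in
/-- Unfolding of `symmetrise`. [folklore] -/
theorem symmetrise_apply (hS : ∀ k ∈ S, -k ∈ S) (c : ↥S → EuclideanSpace ℂ d) (k : ↥S) :
    symmetrise hS c k = (2⁻¹ : ℝ) • (c k + EuclideanSpace.conjVec (c (negIdx hS k))) := rfl

omit [Fintype d] in
/-- The symmetrisation is real. [folklore] -/
theorem isRealCoeff_symmetrise (hS : ∀ k ∈ S, -k ∈ S) (c : ↥S → EuclideanSpace ℂ d) :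
    IsRealCoeff (symmetrise hS c) := by
  intro k l h
  have hl : negIdx hS l = k := Subtype.ext (by rw [coe_negIdx, h, neg_neg])
  have hk : negIdx hS k = l := Subtype.ext (by rw [coe_negIdx, h])
  rw [symmetrise_apply, symmetrise_apply, hl, hk, EuclideanSpace.conjVec_real_smul,
    EuclideanSpace.conjVec_add, EuclideanSpace.conjVec_conjVec, add_comm]

omit [Fintype d] in
/-- Real vectors are fixed by the symmetrisation. [folklore] -/
theorem symmetrise_of_isRealCoeff (hS : ∀ k ∈ S, -k ∈ S) {c : ↥S → EuclideanSpace ℂ d}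
    (hc : IsRealCoeff c) : symmetrise hS c = c := by
  funext k
  rw [symmetrise_apply, hc k (negIdx hS k) (coe_negIdx hS k), EuclideanSpace.conjVec_conjVec,
    ← two_smul ℝ (c k), smul_smul]
  norm_num

omit [Fintype d] in
/-- The symmetrisation is additive: differences. [folklore] -/
theorem symmetrise_sub (hS : ∀ k ∈ S, -k ∈ S) (c c' : ↥S → EuclideanSpace ℂ d) :
    symmetrise hS (c - c') = symmetrise hS c - symmetrise hS c' := by
  funext k
  simp only [symmetrise_apply, Pi.sub_apply, EuclideanSpace.conjVec_sub, ← smul_sub]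
  congr 1
  abel

/-- The symmetrisation is a contraction coordinatewise against the sup norm:
`‖(symmetrise c) k‖ ≤ ‖c‖`. [folklore] -/
theorem norm_symmetrise_apply_le (hS : ∀ k ∈ S, -k ∈ S) (c : ↥S → EuclideanSpace ℂ d) (k : ↥S) :
    ‖symmetrise hS c k‖ ≤ ‖c‖ := by
  rw [symmetrise_apply, norm_smul, Real.norm_of_nonneg (by norm_num : (0 : ℝ) ≤ 2⁻¹)]
  have h1 : ‖c k‖ ≤ ‖c‖ := norm_le_pi_norm c k
  have h2 : ‖EuclideanSpace.conjVec (c (negIdx hS k))‖ ≤ ‖c‖ := by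
    rw [EuclideanSpace.norm_conjVec]; exact norm_le_pi_norm c _
  calc 2⁻¹ * ‖c k + EuclideanSpace.conjVec (c (negIdx hS k))‖
      ≤ 2⁻¹ * (‖c k‖ + ‖EuclideanSpace.conjVec (c (negIdx hS k))‖) := by
        gcongr; exact norm_add_le _ _
    _ ≤ 2⁻¹ * (‖c‖ + ‖c‖) := by gcongr
    _ = ‖c‖ := by ring

/-- The symmetrisation of a smooth curve of coefficient vectors is smooth. [folklore] -/
theorem ContDiff.symmetrise (hS : ∀ k ∈ S, -k ∈ S) {g : ℝ → ↥S → EuclideanSpace ℂ d}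
    {n : WithTop ℕ∞} (hg : ContDiff ℝ n g) : ContDiff ℝ n fun t => symmetrise hS (g t) := by
  refine contDiff_pi.2 fun k => ?_
  have hk : ContDiff ℝ n fun t => g t k := contDiff_pi.1 hg k
  have hk' : ContDiff ℝ n fun t => g t (negIdx hS k) := contDiff_pi.1 hg _
  have hconj : ContDiff ℝ n fun t => EuclideanSpace.conjVec (g t (negIdx hS k)) :=
    (EuclideanSpace.conjVecL (ι := d)).contDiff.comp hk'
  exact (hk.add hconj).const_smul (2⁻¹ : ℝ)

end Symmetrise

end CoeffVector

end Torus

end Literature.Analysis.FunctionSpaces
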